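import Mathlib.Algebra.Polynomial.RuleOfSigns
import Mathlib.Algebra.Polynomial.Roots
import Mathlib.Algebra.Polynomial.Reverse
import Literature.Computability.AlgebraicComplexity.RealTauKnownCases
import Mathlib.FieldTheory.IsRealClosed.Basic
import Literature.Algebra.Polynomial.DescartesSignVariations
import HarnessLib

/-!
# Avendaño 2009: the number of real roots of a lacunary bivariate polynomial on a line

M. Avendaño, *The number of roots of a lacunary bivariate polynomial on a line*, J. Symbolic
Comput. **44** (2009) 1280–1284, doi:10.1016/j.jsc.2008.02.016 [Avendano2009] (held text
`paper:doi-10-1016-j-jsc-2008-02-016`; page `p.N` below = printed page, `Lnn` = line of the held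
text file `p000(N−1279).txt`). A theorem-only file (no named facts): every numbered statement of
§2 and the Proposition of §3 is PROVED, in the tree's vocabulary — Mathlib's
`Polynomial.signVariations` (`Mathlib/Algebra/Polynomial/RuleOfSigns.lean`, Descartes' rule
`Polynomial.roots_countP_pos_le_signVariations`) is the ONE notion of `V`; the sparse Descartes
counts `signVariations_lt_card_support`, `card_support_sum_le`, `support_comp_neg_X` come from
`Literature.Computability.AlgebraicComplexity` (`RealTauKnownCases.lean`), the roots of the reversed
polynomial from `Literature.Algebra.Polynomial.Descartes.roots_reverse_of_ne_zero`
(`DescartesSignVariations.lean`), odd-degree real roots from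
`IsRealClosed.exists_isRoot_of_odd_natDegree` (Mathlib; Prop. 8 is stated over any real closed ordered
field, `ℝ` being one by the tree's `Literature.ModelTheory.ExponentialFields.isRealClosed_real`).

## Dictionary (source item → Lean → status)

* Def. 2 (p.1281 L61–62), `V(f)` = changes of signs skipping zeros → `Polynomial.signVariations`
  (Mathlib). TYPED ≠ PRINTED in one convention: the print sets `V(0) = −2`, Mathlib has
  `V(0) = 0`; the print uses `−2` only to start the induction of Prop. 7 at `f_{n+1} = 0`
  ("the only reason for defining `V(0) = −2` is [Remark 6] in the case `f = 0` and `t = 1`",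
  p.1282 L88–89); here the induction starts one step later (at `f = a₀(x)`, where Descartes' own
  count `V(a₀) ≤ t₀ − 1 ≤ 2t₀ − 2` holds), so the printed constants `2t − 2` and `6t − 4` are KEPT.
* Rem. 3 (p.1281 L63) → `Avendano2009_rem_3`, `signVariations_comp_C_mul_X` — proved.
* Thm. 4 (Descartes' rule) → Mathlib `Polynomial.roots_countP_pos_le_signVariations` (cited, not
  restated).
* **Lemma 5** (p.1282 L5) `V((x + r) f) ≤ V(f)` for `r > 0` → `signVariations_X_add_C_mul_le` —
  proved verbatim (any `f`, incl. `f = 0`), over any linearly ordered commutative ring, directly for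
  general `r` (the print reduces to `r = 1` by Rem. 3; same three-case table); iterated forms
  `signVariations_prod_X_add_C_mul_le`, `signVariations_X_add_C_pow_mul_le`.
* Rem. 6 (p.1282 L87) `V(f + g) ≤ V(f) + 2t` for `g` with `t` terms (`g.support.card`) →
  `signVariations_add_le_add_two_mul_card_support` (one monomial: `signVariations_add_C_mul_X_pow_le`)
  — proved.
* **Prop. 7** (p.1282 L90–111) → `Avendano2009_prop_7`: `f : R[x][y]` (`Polynomial (Polynomial R)`,
  outer variable `y`), its number of non-zero terms is EXACTLY the printed `t = t₁ + ⋯ + tₙ`, namely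
  `Σ_{j ∈ supp_y f} #supp (aⱼ)`, `p = ∏_{i ∈ s} (x + rᵢ)` over a finset with all `rᵢ > 0` (`n ≥ 0`),
  `f(x, p(x)) = f.eval p`, conclusion `V + 2 ≤ 2t` for `f ≠ 0` — proved (Horner form of the printed
  recursion `f_k = y^{α_{k+1}−α_k} f_{k+1} + a_k`). Family form `Avendano2009_prop_7_family`.
* **Thm. 1** (p.1281 L17–23; proof p.1283 L5–30) → namespace `Avendano2009`: the `t` terms of `f`
  are an explicitly indexed family `cᵢ x^{αᵢ} y^{βᵢ}` (`t = #ι`; a polynomial with at most `t`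
  non-zero terms is exactly such a sum, repetitions/zeros allowed), `g = Σᵢ cᵢ x^{αᵢ}(ax + b)^{βᵢ}`:
  - main clause `thm_1` (binder `a ≠ 0` explicit; the disjunct `g = 0` explicit; count = roots
    off `{0, −b/a}` WITH multiplicity `+ [g(0)=0] + [g(−b/a)=0] ≤ 6t − 4`) — proved;
  - `a = 0` (horizontal line; "`−b/a`" undefined in print) as the remark theorem
    `thm_1_of_a_eq_zero`: `g` is `t`-sparse, count `≤ 2t − 1` (the first sentence of the printed
    proof) — proved;
  - the "Moreover" clause WITH multiplicity on the three open intervals, `thm_1_moreover_pos`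
    (`b/a > 0`: `(−∞,−b/a)`, `(−b/a,0)`, `(0,∞)`) and `thm_1_moreover_neg` (`b/a < 0`: `(−∞,0)`,
    `(0,−b/a)`, `(−b/a,∞)`), each `count + 2 ≤ 2t` — proved;
  - distinct-roots corollary `thm_1_card_roots_le` (typed ⊊ printed; any `a, b`) and the same for
    `f` given as an element of `K[x][y]` with `t` read off `f`, `thm_1_card_roots_le_of_bivariate`.
  The case `a = b = 1` is `line_one_one` with its three counts `countP_roots_pos_le`
  (Prop. 7 + Descartes), `countP_roots_lt_neg_one_le` (`x ↦ −1 − x`, printed `f₁`),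
  `countP_roots_Ioo_le` — here ONE DEVIATION from the printed proof: instead of
  `(x+1)^{deg g} g(−x/(x+1)) = f₂(x, x+1)` (p.1283 L25–29, which tacitly needs
  `deg g ≥ αᵢ + βᵢ`, false under cancellation) the roots in `(−1, 0)` are sent to `(−∞, −1)` by
  `x ↦ 1/x`, i.e. by `Polynomial.reflect D` with `D = Σᵢ (αᵢ + βᵢ)` (`reflect_eq`), which keeps the
  shape `Σ cᵢ x^{D−αᵢ−βᵢ}(x+1)^{βᵢ}`; the general line is reduced to `a = b = 1` by the printed
  rescaling `x ↦ (b/a) x` (`comp_C_mul_X_line`). Statements over any linearly ordered field `K`.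
  The "Moreover" clause restated on the sign cell `{x > 0, ax + b > 0}` in the statement shape of
  `KPT2015_cor_14` (zero SET, `encard`, any `a, b`): `encard_zeros_cell_le` (`≤ 2t − 2`).
* **Prop. 8** (p.1283 L69–76) → `Avendano2009.prop_8` over any real closed ordered field (`ℝ`:
  `haveI := isRealClosed_real`) — PROVED WITH A CORRECTED
  HYPOTHESIS `b ≠ 0 ∧ a + b ≠ 1 ∧ a − b ≠ 1` in place of the printed `b ≠ |1 − a|`, and
  `prop_8_asPrinted_counterexample`: **the printed statement is false** (`(a, b) = (0, 0)`,
  `f = x⁷`, `n ∈ {3, 5, 7}`; the printed proof's "`w^{nᵢ−nⱼ} = 1` and therefore `w = ±1`" omits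
  `w = 0`, and `b ≠ |1 − a|` never excludes `w = −1`). The algorithm TEST and its bit-complexity
  bound (p.1283 L86 – p.1284) are NOT typed (algorithmic); note that TEST returns `True` on the
  input `f = x⁷, (a, b) = (0, 0)` although `y ∤ x⁷`.

## Context (honest framing)

A V1 / real-τ DICTIONARY entry for `Summits/ValiantsHypothesis`: the sector `m = 2`,
`f_j ∈ {x, ax + b}` of the sums-of-products-of-sparse-powers format named in the RealTau crux text
and the LacunarySymmetroid NUMBERS. The tree already holds the CUBIC bound for exactly this family
on ONE sign cell, `Literature.Computability.AlgebraicComplexity.KoiranPortierTavenas2015.KPT2015_cor_14`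
(`Z_{x>0, ax+b>0} ≤ 2k³/3 + 5k`, real exponents, Wronskians); Avendaño's bound is LINEAR — `2t − 2`
per cell with multiplicity, `6t − 4` on the whole line — for integer exponents, by Descartes' rule
and Lemma 5; `Avendano2009.encard_zeros_cell_le` states the per-cell bound in the exact shape of
`KPT2015_cor_14` (natural exponents: `≤ 2t − 2`). Later sharpened to `6t − 7`, optimal for `t = 3`
(F. Bihan, B. El Hilany, J. Symbolic Comput. 81 (2017), arXiv:1506.03309, via real dessins
d'enfants) — typed in the sequel `Literature.Algebra.Polynomial.SparseCurveLineSharpBound` (with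
the binder `t ≥ 3` the printed statement needs: it fails for `t = 2`). Census-neutral (0 named
facts); moves no route item; VP ≠ VNP is NOT proved and nothing here bears on it.

## References

* [Avendano2009] M. Avendaño, J. Symbolic Comput. 44 (2009) 1280–1284,
  doi:10.1016/j.jsc.2008.02.016.
* [KoiranPortierTavenas2015] P. Koiran, N. Portier, S. Tavenas, J. Symbolic Comput. 68 (2015)
  195–214, Cor. 14 (the cubic bound for the same family).
* F. Bihan, B. El Hilany, *A sharp bound on the number of real intersection points of a sparse
  plane curve with a line*, J. Symbolic Comput. 81 (2017) 88–96, arXiv:1506.03309 (context only).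
-/

noncomputable section

open Polynomial Finset

namespace Literature.Algebra.Polynomial

/-! ## §2 "Changes of signs": the sign-variation calculus -/

section SignVariations

/-- An indicator is at most `1`. [folklore] -/
private theorem ite_le_one (p : Prop) [Decidable p] : (if p then 1 else 0 : ℕ) ≤ 1 := by
  split_ifs <;> simp

section Semiring

variable {R : Type*} [Semiring R] [LinearOrder R]

/-- Sign variations of "top term + tail": if `deg P < d` and `a ≠ 0` then
`V(a X^d + P) = V(P) + [sign a = −sign lead P]` (Mathlib's `signVariations_eq_eraseLead_add_ite`
read through `eraseLead (a X^d + P) = P`) — the bookkeeping behind the coefficient tables of the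
printed proof of Lemma 5. [cite: Avendano2009, Lemma 5 (proof, p.1282 L5–34: the tables)] -/
theorem signVariations_C_mul_X_pow_add {a : R} (ha : a ≠ 0) {d : ℕ} {P : R[X]}
    (hP : P.degree < d) :
    (C a * X ^ d + P).signVariations =
      P.signVariations + if SignType.sign a = -SignType.sign P.leadingCoeff then 1 else 0 := by
  have hdeg : P.degree < (C a * X ^ d).degree := by rwa [degree_C_mul_X_pow d ha]
  have hlc : (C a * X ^ d + P).leadingCoeff = a := by
    rw [leadingCoeff_add_of_degree_lt' hdeg, leadingCoeff_C_mul_X_pow]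
  have hne : C a * X ^ d + P ≠ 0 := fun h => ha (by rw [← hlc, h, leadingCoeff_zero])
  rw [signVariations_eq_eraseLead_add_ite hne, eraseLead_add_of_degree_lt_left hdeg,
    eraseLead_C_mul_X_pow, zero_add, hlc]

/-- `V(P) ≤ V(a X^d + P) ≤ V(P) + 1` for `deg P < d`, `a ≠ 0`.
[cite: Avendano2009, Lemma 5 (proof, p.1282 L5–34: the tables)] -/
theorem signVariations_C_mul_X_pow_add_le {a : R} (ha : a ≠ 0) {d : ℕ} {P : R[X]}
    (hP : P.degree < d) :
    (C a * X ^ d + P).signVariations ≤ P.signVariations + 1 := by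
  rw [signVariations_C_mul_X_pow_add ha hP]
  exact Nat.add_le_add_left (ite_le_one _) _

/-- `V(P) ≤ V(a X^d + P)` for `deg P < d`, `a ≠ 0`.
[cite: Avendano2009, Lemma 5 (proof, p.1282 L5–34: the tables)] -/
theorem le_signVariations_C_mul_X_pow_add {a : R} (ha : a ≠ 0) {d : ℕ} {P : R[X]}
    (hP : P.degree < d) :
    P.signVariations ≤ (C a * X ^ d + P).signVariations := by
  rw [signVariations_C_mul_X_pow_add ha hP]
  exact Nat.le_add_right _ _

end Semiring

section Ring

variable {R : Type*} [CommRing R] [LinearOrder R] [IsStrictOrderedRing R]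

/-- **Avendaño 2009, Lemma 5** (p. 1282): "Let `f ∈ ℝ[x]` and let `r > 0`. Then
`V((x + r) f) ≤ V(f)`" — adding a NEGATIVE root does not increase the number of sign changes
(the companion of the fact behind Descartes' rule, `V((x − r) f) ≥ V(f) + 1`, Mathlib
`Polynomial.succ_signVariations_le_X_sub_C_mul`). Stated over any linearly ordered commutative
ring; the printed proof (induction on the number of terms, peeling the top term, with its
three-case table) is followed for general `r > 0` instead of reducing to `r = 1` by Remark 3.
[cite: Avendano2009, Lemma 5, doi:10.1016/j.jsc.2008.02.016 p.1282 L5–34] -/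
theorem signVariations_X_add_C_mul_le {r : R} (hr : 0 < r) (P : R[X]) :
    ((X + C r) * P).signVariations ≤ P.signVariations := by
  induction h : P.support.card using Nat.strong_induction_on generalizing P with
  | _ n ih =>
  by_cases hP0 : P = 0
  · simp [hP0]
  -- wlog the leading coefficient is positive
  wlog hpos : 0 < P.leadingCoeff generalizing P with H
  · have hneg : 0 < (-P).leadingCoeff := by
      rw [leadingCoeff_neg, neg_pos]
      exact lt_of_le_of_ne (not_lt.mp hpos) (leadingCoeff_ne_zero.mpr hP0)
    have := H (-P) (by rwa [support_neg]) (neg_ne_zero.mpr hP0) hneg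
    rwa [mul_neg, signVariations_neg, signVariations_neg] at this
  set a := P.leadingCoeff with ha_def
  set d := P.natDegree with hd_def
  set G := P.eraseLead with hG_def
  have ha : a ≠ 0 := hpos.ne'
  have hsa : SignType.sign a = 1 := sign_pos hpos
  have hPdec : C a * X ^ d + G = P := by
    rw [add_comm]; exact eraseLead_add_C_mul_X_pow P
  have hPdeg : P.degree = d := degree_eq_natDegree hP0
  have hGdeg : G.degree < d := hPdeg ▸ degree_eraseLead_lt hP0
  have hGcard : G.support.card < n := h ▸ eraseLead_support_card_lt hP0
  have ihG : ((X + C r) * G).signVariations ≤ G.signVariations := ih _ hGcard G rfl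
  have hVP : P.signVariations =
      G.signVariations + if (1 : SignType) = -SignType.sign G.leadingCoeff then 1 else 0 := by
    rw [← hPdec, signVariations_C_mul_X_pow_add ha hGdeg, hsa]
  set H := (X + C r) * G with hH_def
  have hHlc : H.leadingCoeff = G.leadingCoeff := leadingCoeff_monic_mul (monic_X_add_C r)
  have hra : r * a ≠ 0 := mul_ne_zero hr.ne' ha
  have hsra : SignType.sign (r * a) = 1 := sign_pos (mul_pos hr hpos)
  have hprod : (X + C r) * P = C a * X ^ (d + 1) + (C (r * a) * X ^ d + H) := by
    rw [← hPdec, hH_def, C_mul]; ring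
  have hdd : ((d : ℕ) : WithBot ℕ) < ((d + 1 : ℕ) : WithBot ℕ) := by
    exact_mod_cast Nat.lt_succ_self d
  by_cases hHd : H.degree < d
  · -- Case "α_n < d - 1": no overlap of the top two terms with `(x + r) g`
    have hKdeg : (C (r * a) * X ^ d + H).degree = (d : WithBot ℕ) := by
      rw [degree_add_eq_left_of_degree_lt (by rwa [degree_C_mul_X_pow d hra]),
        degree_C_mul_X_pow d hra]
    have hKlc : (C (r * a) * X ^ d + H).leadingCoeff = r * a := by
      rw [leadingCoeff_add_of_degree_lt' (by rwa [degree_C_mul_X_pow d hra]),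
        leadingCoeff_C_mul_X_pow]
    rw [hprod, signVariations_C_mul_X_pow_add ha (hKdeg ▸ hdd), hKlc, hsra, hsa,
      signVariations_C_mul_X_pow_add hra hHd, hsra, hHlc, hVP]
    simp only [show ¬ ((1 : SignType) = -1) by decide, if_false, add_zero]
    exact Nat.add_le_add_right ihG _
  · -- Case "α_n = d - 1": the top two terms overlap with `(x + r) g`
    have hH0 : H ≠ 0 := by
      intro h0; rw [h0, degree_zero] at hHd; exact hHd (WithBot.bot_lt_coe d)
    have hG0 : G ≠ 0 := by
      intro h0; exact hH0 (by rw [hH_def, h0, mul_zero])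
    have hHnat : H.natDegree = d := by
      have h1 : H.natDegree = G.natDegree + 1 := by
        rw [hH_def, natDegree_mul (X_add_C_ne_zero r) hG0, natDegree_X_add_C, add_comm]
      have h2 : G.natDegree < d := by
        have := hGdeg; rw [degree_eq_natDegree hG0] at this; exact_mod_cast this
      have h3 : d ≤ H.natDegree := by
        have := not_lt.mp hHd; rw [degree_eq_natDegree hH0] at this; exact_mod_cast this
      omega
    set b := G.leadingCoeff with hb_def
    have hb : b ≠ 0 := leadingCoeff_ne_zero.mpr hG0
    set Q := H.eraseLead with hQ_def
    have hHdec : C b * X ^ d + Q = H := by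
      have := eraseLead_add_C_mul_X_pow H
      rw [hHnat, hHlc] at this
      rw [add_comm]; exact this
    have hQdeg : Q.degree < d := by
      have := degree_eraseLead_lt hH0
      rwa [degree_eq_natDegree hH0, hHnat] at this
    have hVH : H.signVariations = Q.signVariations +
        if SignType.sign b = -SignType.sign Q.leadingCoeff then 1 else 0 := by
      rw [← hHdec, signVariations_C_mul_X_pow_add hb hQdeg]
    -- `(x + r) f = a x^{d+1} + (b + r a) x^d + Q`
    have hprod' : (X + C r) * P = C a * X ^ (d + 1) + (C (b + r * a) * X ^ d + Q) := by
      rw [hprod, ← hHdec, C_add]; ring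
    have hQle : Q.signVariations ≤ G.signVariations :=
      (le_signVariations_C_mul_X_pow_add hb hQdeg).trans (hHdec.symm ▸ ihG)
    rcases lt_or_gt_of_ne hb with hbneg | hbpos
    · -- `a_n a_{n+1} < 0`: `V(f) = V(g) + 1`
      have hsb : SignType.sign b = -1 := sign_neg hbneg
      have hVP' : P.signVariations = G.signVariations + 1 := by
        rw [hVP, hsb]; simp
      rw [hVP']
      rcases lt_trichotomy (b + r * a) 0 with hc | hc | hc
      · -- `|a_n| > r |a_{n+1}|`: top signs `[+, -, …]`
        have hKlc : (C (b + r * a) * X ^ d + Q).leadingCoeff = b + r * a := by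
          rw [leadingCoeff_add_of_degree_lt' (by rwa [degree_C_mul_X_pow d hc.ne]),
            leadingCoeff_C_mul_X_pow]
        have hKdeg : (C (b + r * a) * X ^ d + Q).degree = (d : WithBot ℕ) := by
          rw [degree_add_eq_left_of_degree_lt (by rwa [degree_C_mul_X_pow d hc.ne]),
            degree_C_mul_X_pow d hc.ne]
        rw [hprod', signVariations_C_mul_X_pow_add ha (hKdeg ▸ hdd), hKlc, hsa, sign_neg hc,
          signVariations_C_mul_X_pow_add hc.ne hQdeg, sign_neg hc]
        rw [hsb] at hVH
        simp only [neg_neg, if_true]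
        rw [← hVH, hHdec] at *
        exact Nat.add_le_add_right ihG 1
      · -- `|a_n| = r |a_{n+1}|`: the `x^d` coefficient vanishes
        have hK : C (b + r * a) * X ^ d + Q = Q := by rw [hc, C_0, zero_mul, zero_add]
        rw [hprod', hK, signVariations_C_mul_X_pow_add ha (lt_trans hQdeg hdd)]
        exact Nat.add_le_add hQle (ite_le_one _)
      · -- `|a_n| < r |a_{n+1}|`: top signs `[+, +, …]`
        have hKlc : (C (b + r * a) * X ^ d + Q).leadingCoeff = b + r * a := by
          rw [leadingCoeff_add_of_degree_lt' (by rwa [degree_C_mul_X_pow d hc.ne']),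
            leadingCoeff_C_mul_X_pow]
        have hKdeg : (C (b + r * a) * X ^ d + Q).degree = (d : WithBot ℕ) := by
          rw [degree_add_eq_left_of_degree_lt (by rwa [degree_C_mul_X_pow d hc.ne']),
            degree_C_mul_X_pow d hc.ne']
        rw [hprod', signVariations_C_mul_X_pow_add ha (hKdeg ▸ hdd), hKlc, hsa, sign_pos hc,
          signVariations_C_mul_X_pow_add hc.ne' hQdeg, sign_pos hc]
        simp only [show ¬ ((1 : SignType) = -1) by decide, if_false, add_zero]
        exact Nat.add_le_add hQle (ite_le_one _)
    · -- `a_n a_{n+1} > 0`: `V(f) = V(g)` and `b + r a > 0`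
      have hsb : SignType.sign b = 1 := sign_pos hbpos
      have hc : 0 < b + r * a := add_pos hbpos (mul_pos hr hpos)
      have hVP' : P.signVariations = G.signVariations := by
        rw [hVP, hsb]; simp [show ¬ ((1 : SignType) = -1) by decide]
      have hKlc : (C (b + r * a) * X ^ d + Q).leadingCoeff = b + r * a := by
        rw [leadingCoeff_add_of_degree_lt' (by rwa [degree_C_mul_X_pow d hc.ne']),
          leadingCoeff_C_mul_X_pow]
      have hKdeg : (C (b + r * a) * X ^ d + Q).degree = (d : WithBot ℕ) := by
        rw [degree_add_eq_left_of_degree_lt (by rwa [degree_C_mul_X_pow d hc.ne']),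
          degree_C_mul_X_pow d hc.ne']
      rw [hVP', hprod', signVariations_C_mul_X_pow_add ha (hKdeg ▸ hdd), hKlc, hsa, sign_pos hc,
        signVariations_C_mul_X_pow_add hc.ne' hQdeg, sign_pos hc]
      simp only [show ¬ ((1 : SignType) = -1) by decide, if_false, add_zero]
      rw [hsb] at hVH
      rw [← hVH]
      exact ihG

/-- Lemma 5 iterated over a product of factors `x + rᵢ`, `rᵢ > 0`:
`V((∏ᵢ (x + rᵢ)) f) ≤ V(f)`. [cite: Avendano2009, Lemma 5] -/
theorem signVariations_prod_X_add_C_mul_le {ι : Type*} (s : Finset ι) (r : ι → R)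
    (hr : ∀ i ∈ s, 0 < r i) (P : R[X]) :
    ((∏ i ∈ s, (X + C (r i))) * P).signVariations ≤ P.signVariations := by
  classical
  induction s using Finset.induction_on generalizing P with
  | empty => simp
  | insert a s ha ih =>
    rw [Finset.prod_insert ha, mul_assoc]
    exact (signVariations_X_add_C_mul_le (hr a (Finset.mem_insert_self a s)) _).trans
      (ih (fun i hi => hr i (Finset.mem_insert_of_mem hi)) P)

/-- Powers: `V((x + r)^k f) ≤ V(f)` for `r > 0`. [cite: Avendano2009, Lemma 5] -/
theorem signVariations_X_add_C_pow_mul_le {r : R} (hr : 0 < r) (k : ℕ) (P : R[X]) :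
    ((X + C r) ^ k * P).signVariations ≤ P.signVariations := by
  induction k generalizing P with
  | zero => simp
  | succ k ih =>
    rw [pow_succ, mul_assoc]
    exact (ih _).trans (signVariations_X_add_C_mul_le hr P)

omit [IsStrictOrderedRing R] in
/-- Remark 6, one monomial, in the strengthened form that makes the induction run: for every
"virtual top sign" `s`, `V(f + c x^e) + [s = −sign lead(f + c x^e)] ≤ V(f) + [s = −sign lead f] + 2`.
[cite: Avendano2009, Remark 6 (proof device)] -/
private theorem signVariations_add_C_mul_X_pow_aux (c : R) (e : ℕ) :
    ∀ (P : R[X]) (s : SignType),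
      (P + C c * X ^ e).signVariations +
          (if s = -SignType.sign (P + C c * X ^ e).leadingCoeff then 1 else 0) ≤
        P.signVariations + (if s = -SignType.sign P.leadingCoeff then 1 else 0) + 2 := by
  intro P
  by_cases hc : c = 0
  · intro s; simp [hc]
  induction h : P.support.card using Nat.strong_induction_on generalizing P with
  | _ n ih =>
  intro s
  have hme : (C c * X ^ e).degree = (e : WithBot ℕ) := degree_C_mul_X_pow e hc
  by_cases hP0 : P = 0
  · subst hP0
    rw [zero_add, leadingCoeff_C_mul_X_pow, C_mul_X_pow_eq_monomial, signVariations_monomial]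
    simp only [signVariations_zero, leadingCoeff_zero, zero_add]
    exact (ite_le_one _).trans (by omega)
  rcases lt_trichotomy P.natDegree e with hlt | heq | hgt
  · -- `deg f < e`: the new monomial is the top term
    have hPe : P.degree < e := by rw [degree_eq_natDegree hP0]; exact_mod_cast hlt
    have hlc : (P + C c * X ^ e).leadingCoeff = c := by
      rw [add_comm, leadingCoeff_add_of_degree_lt' (by rwa [hme]), leadingCoeff_C_mul_X_pow]
    rw [hlc, add_comm P, signVariations_C_mul_X_pow_add hc hPe]
    have h1 := ite_le_one (SignType.sign c = -SignType.sign P.leadingCoeff)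
    have h2 := ite_le_one (s = -SignType.sign c)
    omega
  · -- `deg f = e`: the monomial merges with the top term of `f`
    set a := P.leadingCoeff with ha_def
    set G := P.eraseLead with hG_def
    have ha : a ≠ 0 := leadingCoeff_ne_zero.mpr hP0
    have hPdec : C a * X ^ e + G = P := by
      rw [add_comm, ha_def, ← heq]; exact eraseLead_add_C_mul_X_pow P
    have hGdeg : G.degree < e := by
      have := degree_eraseLead_lt hP0; rwa [degree_eq_natDegree hP0, heq] at this
    have hsum : P + C c * X ^ e = C (a + c) * X ^ e + G := by
      rw [← hPdec, C_add]; ring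
    have hGle : G.signVariations ≤ P.signVariations := signVariations_eraseLead_le P
    rw [hsum]
    by_cases hac : a + c = 0
    · rw [hac, C_0, zero_mul, zero_add]
      have h1 := ite_le_one (s = -SignType.sign G.leadingCoeff)
      omega
    · have hlc : (C (a + c) * X ^ e + G).leadingCoeff = a + c := by
        rw [leadingCoeff_add_of_degree_lt' (by rwa [degree_C_mul_X_pow e hac]),
          leadingCoeff_C_mul_X_pow]
      rw [hlc, signVariations_C_mul_X_pow_add hac hGdeg]
      have h1 := ite_le_one (SignType.sign (a + c) = -SignType.sign G.leadingCoeff)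
      have h2 := ite_le_one (s = -SignType.sign (a + c))
      omega
  · -- `deg f > e`: peel the top term of `f` and induct
    set a := P.leadingCoeff with ha_def
    set d := P.natDegree with hd_def
    set G := P.eraseLead with hG_def
    have ha : a ≠ 0 := leadingCoeff_ne_zero.mpr hP0
    have hPdec : C a * X ^ d + G = P := by
      rw [add_comm]; exact eraseLead_add_C_mul_X_pow P
    have hGdeg : G.degree < d := by
      have := degree_eraseLead_lt hP0; rwa [degree_eq_natDegree hP0] at this
    have hedeg : (C c * X ^ e).degree < (d : WithBot ℕ) := by rw [hme]; exact_mod_cast hgt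
    have hGmdeg : (G + C c * X ^ e).degree < (d : WithBot ℕ) :=
      lt_of_le_of_lt (degree_add_le _ _) (max_lt hGdeg hedeg)
    have hsum : P + C c * X ^ e = C a * X ^ d + (G + C c * X ^ e) := by
      rw [← hPdec]; ring
    have hlc : (C a * X ^ d + (G + C c * X ^ e)).leadingCoeff = a := by
      rw [leadingCoeff_add_of_degree_lt' (by rwa [degree_C_mul_X_pow d ha]),
        leadingCoeff_C_mul_X_pow]
    have hGcard : G.support.card < n := h ▸ eraseLead_support_card_lt hP0
    have ihG := ih _ hGcard G rfl (SignType.sign a)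
    have hVP : P.signVariations = G.signVariations +
        if SignType.sign a = -SignType.sign G.leadingCoeff then 1 else 0 := by
      rw [← hPdec, signVariations_C_mul_X_pow_add ha hGdeg]
    have hVsum : (P + C c * X ^ e).signVariations = (G + C c * X ^ e).signVariations +
        if SignType.sign a = -SignType.sign (G + C c * X ^ e).leadingCoeff then 1 else 0 := by
      rw [hsum, signVariations_C_mul_X_pow_add ha hGmdeg]
    have hlcsum : (P + C c * X ^ e).leadingCoeff = a := by rw [hsum, hlc]
    rw [hVsum, hlcsum, hVP]
    have h2 := ite_le_one (s = -SignType.sign a)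
    omega

omit [IsStrictOrderedRing R] in
/-- Adding one monomial changes the number of sign variations by at most `2`.
[cite: Avendano2009, Remark 6] -/
theorem signVariations_add_C_mul_X_pow_le (P : R[X]) (c : R) (e : ℕ) :
    (P + C c * X ^ e).signVariations ≤ P.signVariations + 2 := by
  by_cases hP0 : P = 0
  · subst hP0
    rw [zero_add, C_mul_X_pow_eq_monomial, signVariations_monomial]; simp
  have hs : SignType.sign P.leadingCoeff ≠ 0 := by
    rw [Ne, sign_eq_zero_iff]; exact leadingCoeff_ne_zero.mpr hP0
  have h := signVariations_add_C_mul_X_pow_aux c e P (SignType.sign P.leadingCoeff)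
  have hfalse : ¬ (SignType.sign P.leadingCoeff = -SignType.sign P.leadingCoeff) := by
    intro h'; apply hs
    rcases h3 : SignType.sign P.leadingCoeff with _ | _ | _ <;> rw [h3] at h' <;> revert h' <;> decide
  rw [if_neg hfalse, add_zero] at h
  exact le_trans (Nat.le_add_right _ _) h

omit [IsStrictOrderedRing R] in
/-- **Avendaño 2009, Remark 6** (p. 1282): "Let `f, g ∈ ℝ[x]` and suppose that `g` has `t` terms.
Then `V(f + g) ≤ V(f) + 2t`." (With Mathlib's `V(0) = 0`; the printed convention `V(0) = −2`
only sharpens the case `f = 0`, `t = 1`, which is not needed below.)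
[cite: Avendano2009, Remark 6, doi:10.1016/j.jsc.2008.02.016 p.1282 L87] -/
theorem signVariations_add_le_add_two_mul_card_support (P Q : R[X]) :
    (P + Q).signVariations ≤ P.signVariations + 2 * Q.support.card := by
  induction h : Q.support.card using Nat.strong_induction_on generalizing Q with
  | _ n ih =>
  by_cases hQ0 : Q = 0
  · subst hQ0; simp
  have hQdec : Q.eraseLead + C Q.leadingCoeff * X ^ Q.natDegree = Q := eraseLead_add_C_mul_X_pow Q
  have hcard : Q.eraseLead.support.card < n := h ▸ eraseLead_support_card_lt hQ0
  have hcard' : Q.eraseLead.support.card + 1 = n := h ▸ card_support_eraseLead_add_one hQ0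
  have ih' := ih _ hcard Q.eraseLead rfl
  calc (P + Q).signVariations
      = ((P + Q.eraseLead) + C Q.leadingCoeff * X ^ Q.natDegree).signVariations := by
        rw [add_assoc, hQdec]
    _ ≤ (P + Q.eraseLead).signVariations + 2 := signVariations_add_C_mul_X_pow_le _ _ _
    _ ≤ P.signVariations + 2 * Q.eraseLead.support.card + 2 := by omega
    _ = P.signVariations + 2 * n := by rw [← hcard']; ring

end Ring

end SignVariations

/-! ## Proposition 7: `V(f(x, p(x))) ≤ 2t − 2` -/

section Prop7

variable {R : Type*} [CommRing R] [LinearOrder R] [IsStrictOrderedRing R]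

omit [LinearOrder R] [IsStrictOrderedRing R] in
/-- The number of terms of `f ∈ R[x][y]` summed degree by degree in `y` over `j < N` equals the
number of terms summed over the `y`-support, when `N` exceeds the `y`-degree. [folklore] -/
private theorem sum_range_card_support_coeff (f : Polynomial (Polynomial R)) {N : ℕ}
    (hN : f.natDegree < N) :
    ∑ j ∈ Finset.range N, (f.coeff j).support.card = ∑ j ∈ f.support, (f.coeff j).support.card := by
  symm
  apply Finset.sum_subset
  · intro j hj
    exact Finset.mem_range.mpr (lt_of_le_of_lt (le_natDegree_of_mem_supp j hj) hN)
  · intro j _ hj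
    rw [notMem_support_iff.mp hj, support_zero, Finset.card_empty]

/-- Proposition 7 in "range" form (the induction actually run: Horner's scheme in `y`, i.e.
`f = y · divX f + a₀(x)`, so that `f(x,p) = p · (divX f)(x,p) + a₀(x)`; multiplying by `p` is free
by Lemma 5 and adding `a₀` costs `2 t₀` by Remark 6). [cite: Avendano2009, Prop. 7 (proof)] -/
private theorem signVariations_eval_prod_aux {ι : Type*} (s : Finset ι) (r : ι → R)
    (hr : ∀ i ∈ s, 0 < r i) :
    ∀ (N : ℕ) (f : Polynomial (Polynomial R)), f ≠ 0 → f.natDegree < N →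
      (f.eval (∏ i ∈ s, (X + C (r i)))).signVariations + 2 ≤
        2 * ∑ j ∈ Finset.range N, (f.coeff j).support.card := by
  intro N
  induction N with
  | zero => intro f _ h; exact absurd h (Nat.not_lt_zero _)
  | succ N ih =>
    intro f hf hdeg
    set p := ∏ i ∈ s, (X + C (r i)) with hp_def
    have hfdec : X * f.divX + C (f.coeff 0) = f := X_mul_divX_add f
    have heval : f.eval p = p * (f.divX.eval p) + f.coeff 0 := by
      conv_lhs => rw [← hfdec]
      rw [eval_add, eval_mul, eval_X, eval_C]
    rw [Finset.sum_range_succ', heval]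
    simp only [coeff_divX.symm]
    by_cases hD : f.divX = 0
    · -- `f = a₀(x)`: Descartes' count `V(a₀) ≤ t₀ - 1`
      have hf0 : f.coeff 0 ≠ 0 := by
        intro h0; apply hf
        rw [← hfdec, hD, h0, mul_zero, C_0, zero_add]
      rw [hD, eval_zero, mul_zero, zero_add]
      have h1 := Literature.Computability.AlgebraicComplexity.signVariations_lt_card_support hf0
      simp only [coeff_zero, support_zero, Finset.card_empty, Finset.sum_const_zero, zero_add]
      omega
    · have hdegD : f.divX.natDegree < N := by
        rw [natDegree_divX_eq_natDegree_tsub_one]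
        have : 0 < f.natDegree := by
          by_contra h0
          apply hD
          rw [divX_eq_zero_iff]
          exact eq_C_of_natDegree_eq_zero (Nat.eq_zero_of_not_pos h0)
        omega
      have ih' := ih f.divX hD hdegD
      have h1 := signVariations_add_le_add_two_mul_card_support (p * f.divX.eval p) (f.coeff 0)
      have h2 := signVariations_prod_X_add_C_mul_le s r hr (f.divX.eval p)
      rw [← hp_def] at h2
      omega

/-- **Avendaño 2009, Proposition 7** (p. 1282): "Let `f ∈ ℝ[x, y]` with `t` non-zero terms. Let
`p = (x + r₁) ⋯ (x + rₙ) ∈ ℝ[x]` where `rᵢ > 0` for all `i`. Then `V(f(x, p(x))) ≤ 2t − 2`."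
Here `f : R[x][y]` (a polynomial in `y` with coefficients `aⱼ(x) ∈ R[x]`), its number of non-zero
terms is `t = Σ_{j} #supp aⱼ`, `f(x, p(x)) = f.eval p`, and the bound is written `V + 2 ≤ 2t` for
`f ≠ 0` (for `f = 0` the print's `V(0) = −2` makes it trivially true). Any linearly ordered
commutative ring `R`. [cite: Avendano2009, Prop. 7, doi:10.1016/j.jsc.2008.02.016 p.1282 L90–111] -/
theorem Avendano2009_prop_7 {ι : Type*} (s : Finset ι) (r : ι → R) (hr : ∀ i ∈ s, 0 < r i)
    (f : Polynomial (Polynomial R)) (hf : f ≠ 0) :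
    (f.eval (∏ i ∈ s, (X + C (r i)))).signVariations + 2 ≤
      2 * ∑ j ∈ f.support, (f.coeff j).support.card := by
  rw [← sum_range_card_support_coeff f (Nat.lt_succ_self _)]
  exact signVariations_eval_prod_aux s r hr _ f hf (Nat.lt_succ_self _)

/-- Proposition 7 for an explicitly listed family of terms `cᵢ x^{αᵢ} y^{βᵢ}` (`i ∈ ι`, repetitions
of exponent pairs allowed — they only lower the true number of terms): if
`g = Σᵢ cᵢ x^{αᵢ} p(x)^{βᵢ} ≠ 0` then `V(g) + 2 ≤ 2 #ι`. [cite: Avendano2009, Prop. 7] -/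
theorem Avendano2009_prop_7_family {κ : Type*} (s : Finset κ) (r : κ → R) (hr : ∀ i ∈ s, 0 < r i)
    {ι : Type*} [Fintype ι] (c : ι → R) (α β : ι → ℕ)
    (hg : ∑ i, C (c i) * X ^ (α i) * (∏ k ∈ s, (X + C (r k))) ^ (β i) ≠ 0) :
    (∑ i, C (c i) * X ^ (α i) * (∏ k ∈ s, (X + C (r k))) ^ (β i)).signVariations + 2 ≤
      2 * Fintype.card ι := by
  classical
  set p := ∏ k ∈ s, (X + C (r k)) with hp_def
  -- the bivariate polynomial `F = Σᵢ (cᵢ x^{αᵢ}) y^{βᵢ}`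
  set F : Polynomial (Polynomial R) := ∑ i, monomial (β i) (C (c i) * X ^ (α i)) with hF_def
  have hFeval : F.eval p = ∑ i, C (c i) * X ^ (α i) * p ^ (β i) := by
    rw [hF_def, eval_finsetSum]
    simp only [eval_monomial]
  have hF0 : F ≠ 0 := by
    intro h0; apply hg; rw [← hFeval, h0, eval_zero]
  have h7 := Avendano2009_prop_7 s r hr F hF0
  rw [hFeval] at h7
  -- `t(F) ≤ #ι`: the `y^j`-coefficient of `F` has at most `#{i | βᵢ = j}` terms
  have hcoeff : ∀ j, F.coeff j = ∑ i ∈ Finset.univ.filter (fun i => β i = j),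
      C (c i) * X ^ (α i) := by
    intro j
    rw [hF_def, finsetSum_coeff, Finset.sum_filter]
    refine Finset.sum_congr rfl fun i _ => ?_
    rw [coeff_monomial]
  have hcard : ∀ j, (F.coeff j).support.card ≤ (Finset.univ.filter (fun i => β i = j)).card := by
    intro j
    rw [hcoeff j]
    refine (Literature.Computability.AlgebraicComplexity.card_support_sum_le _ _).trans ?_
    have h1 : ∀ i, (C (c i) * X ^ (α i)).support.card ≤ 1 := fun i =>
      card_support_C_mul_X_pow_le_one
    calc ∑ i ∈ Finset.univ.filter (fun i => β i = j), (C (c i) * X ^ (α i)).support.card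
        ≤ ∑ i ∈ Finset.univ.filter (fun i => β i = j), 1 :=
          Finset.sum_le_sum (f := fun i => (C (c i) * X ^ (α i)).support.card) (g := fun _ => 1)
            fun i _ => h1 i
      _ = _ := by simp
  have hsupp : F.support ⊆ Finset.univ.image β := by
    intro j hj
    rw [mem_support_iff, hcoeff j] at hj
    obtain ⟨i, hi, -⟩ := Finset.exists_ne_zero_of_sum_ne_zero hj
    exact Finset.mem_image.mpr ⟨i, Finset.mem_univ i, (Finset.mem_filter.mp hi).2⟩
  have htle : ∑ j ∈ F.support, (F.coeff j).support.card ≤ Fintype.card ι := by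
    calc ∑ j ∈ F.support, (F.coeff j).support.card
        ≤ ∑ j ∈ Finset.univ.image β, (F.coeff j).support.card :=
          Finset.sum_le_sum_of_subset_of_nonneg hsupp fun _ _ _ => Nat.zero_le _
      _ ≤ ∑ j ∈ Finset.univ.image β, (Finset.univ.filter (fun i => β i = j)).card :=
          Finset.sum_le_sum fun j _ => hcard j
      _ = (Finset.univ : Finset ι).card :=
          (Finset.card_eq_sum_card_fiberwise fun i hi => Finset.mem_image_of_mem β hi).symm
      _ = Fintype.card ι := Finset.card_univ
  omega

end Prop7

/-! ## Remark 3: `V(k · f(r x)) = V(f)` -/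

section Remark3

variable {R : Type*} [CommRing R] [LinearOrder R] [IsStrictOrderedRing R]

/-- `V(f(r x)) = V(f)` for `r > 0` (the substitution `x ↦ r x` multiplies the coefficient of `x^k`
by `r^k > 0`). [cite: Avendano2009, Remark 3] -/
theorem signVariations_comp_C_mul_X {r : R} (hr : 0 < r) (P : R[X]) :
    (P.comp (C r * X)).signVariations = P.signVariations := by
  induction h : P.support.card using Nat.strong_induction_on generalizing P with
  | _ n ih =>
  by_cases hP0 : P = 0
  · simp [hP0]
  have hq1 : (C r * X).natDegree = 1 := by rw [natDegree_C_mul_X _ hr.ne']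
  have hqlc : (C r * X).leadingCoeff = r := by rw [leadingCoeff_C_mul_X]
  set a := P.leadingCoeff with ha_def
  set d := P.natDegree with hd_def
  set G := P.eraseLead with hG_def
  have ha : a ≠ 0 := leadingCoeff_ne_zero.mpr hP0
  have hPdec : C a * X ^ d + G = P := by rw [add_comm]; exact eraseLead_add_C_mul_X_pow P
  have hGdeg : G.degree < d := by
    have := degree_eraseLead_lt hP0; rwa [degree_eq_natDegree hP0] at this
  have hGcard : G.support.card < n := h ▸ eraseLead_support_card_lt hP0
  have ihG := ih _ hGcard G rfl
  -- `P(r x) = a r^d x^d + G(r x)`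
  have hcomp : P.comp (C r * X) = C (a * r ^ d) * X ^ d + G.comp (C r * X) := by
    rw [← hPdec, add_comp, mul_comp, C_comp, pow_comp, X_comp, mul_pow, ← C_pow, C_mul]; ring
  have hard : a * r ^ d ≠ 0 := mul_ne_zero ha (pow_ne_zero _ hr.ne')
  have hGcdeg : (G.comp (C r * X)).degree < d := by
    by_cases hG0 : G = 0
    · rw [hG0, zero_comp, degree_zero]; exact WithBot.bot_lt_coe d
    · have hGc0 : G.comp (C r * X) ≠ 0 := by
        intro h0
        have := congr_arg leadingCoeff h0
        rw [leadingCoeff_comp (by rw [hq1]; exact one_ne_zero), hqlc, leadingCoeff_zero] at this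
        exact mul_ne_zero (leadingCoeff_ne_zero.mpr hG0) (pow_ne_zero _ hr.ne') this
      rw [degree_eq_natDegree hGc0, natDegree_comp, hq1, mul_one, ← degree_eq_natDegree hG0]
      exact hGdeg
  have hlc : SignType.sign (G.comp (C r * X)).leadingCoeff = SignType.sign G.leadingCoeff := by
    rw [leadingCoeff_comp (by rw [hq1]; exact one_ne_zero), hqlc, sign_mul, sign_pos (pow_pos hr _),
      mul_one]
  rw [hcomp, signVariations_C_mul_X_pow_add hard hGcdeg, ihG, hlc, ← hPdec,
    signVariations_C_mul_X_pow_add ha hGdeg, sign_mul, sign_pos (pow_pos hr _), mul_one]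

/-- **Avendaño 2009, Remark 3** (p. 1281): "Let `f ∈ ℝ[x]`. Then `V(k f(r x)) = V(f)` for all
`k ≠ 0` and `r > 0`." [cite: Avendano2009, Remark 3, doi:10.1016/j.jsc.2008.02.016 p.1281 L63] -/
theorem Avendano2009_rem_3 {k r : R} (hk : k ≠ 0) (hr : 0 < r) (P : R[X]) :
    (C k * P.comp (C r * X)).signVariations = P.signVariations := by
  rw [signVariations_C_mul _ hk, signVariations_comp_C_mul_X hr]

end Remark3

/-! ## Theorem 1 on the line `y = x + 1` -/

namespace Avendano2009

section LineOneOne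

variable {K : Type*} [Field K] [LinearOrder K] [IsStrictOrderedRing K]
variable {ι : Type*} [Fintype ι] (c : ι → K) (α β : ι → ℕ)

/-- Positive roots, with multiplicity, of `g = Σᵢ cᵢ x^{αᵢ} (x+1)^{βᵢ} ≠ 0` number at most
`2t − 2`: Descartes' rule (`Polynomial.roots_countP_pos_le_signVariations`) and Proposition 7
with `p = x + 1`. [cite: Avendano2009, Thm. 1 (proof, positive roots)] -/
theorem countP_roots_pos_le
    (hg : ∑ i, C (c i) * X ^ (α i) * (X + C 1) ^ (β i) ≠ 0) :
    (∑ i, C (c i) * X ^ (α i) * (X + C 1) ^ (β i)).roots.countP (fun x => 0 < x) + 2 ≤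
      2 * Fintype.card ι := by
  have h7 := Avendano2009_prop_7_family (Finset.univ : Finset (Fin 1)) (fun _ => (1 : K))
    (fun _ _ => one_pos) c α β
  simp only [Fin.prod_univ_one] at h7
  have h := h7 hg
  have hD := roots_countP_pos_le_signVariations (∑ i, C (c i) * X ^ (α i) * (X + C 1) ^ (β i))
  omega

omit [LinearOrder K] [IsStrictOrderedRing K] in
/-- The substitution `x ↦ −1 − x`: `g(−1 − x) = Σᵢ cᵢ (−1)^{αᵢ+βᵢ} (x+1)^{αᵢ} x^{βᵢ}` — again of
the same shape, with the exponents swapped. [cite: Avendano2009, Thm. 1 (proof, the polynomial f₁)] -/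
theorem comp_neg_X_sub_one :
    (∑ i, C (c i) * X ^ (α i) * (X + C 1) ^ (β i)).comp (C (-1) * X + C (-1)) =
      ∑ i, C (c i * (-1) ^ (α i + β i)) * X ^ (β i) * (X + C 1) ^ (α i) := by
  rw [Polynomial.sum_comp]
  refine Finset.sum_congr rfl fun i _ => ?_
  simp only [mul_comp, C_comp, pow_comp, X_comp, add_comp]
  have h1 : (C (-1) * X + C (-1) : K[X]) = C (-1) * (X + C 1) := by
    rw [mul_add, ← C_mul, neg_one_mul]
  have h2 : (C (-1) * X + C (-1) + C 1 : K[X]) = C (-1) * X := by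
    rw [add_assoc, ← C_add, neg_add_cancel, C_0, add_zero]
  rw [h2, h1, mul_pow, mul_pow, ← C_pow, ← C_pow, C_mul, pow_add, C_mul]
  ring

/-- Roots in `(−∞, −1)`, with multiplicity, number at most `2t − 2` (apply the positive-root count
to `g(−1 − x)`). [cite: Avendano2009, Thm. 1 (proof, roots in (−∞, −1))] -/
theorem countP_roots_lt_neg_one_le
    (hg : ∑ i, C (c i) * X ^ (α i) * (X + C 1) ^ (β i) ≠ 0) :
    (∑ i, C (c i) * X ^ (α i) * (X + C 1) ^ (β i)).roots.countP (fun x => x < -1) + 2 ≤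
      2 * Fintype.card ι := by
  classical
  set g := ∑ i, C (c i) * X ^ (α i) * (X + C 1) ^ (β i) with hg_def
  set g₁ := ∑ i, C (c i * (-1) ^ (α i + β i)) * X ^ (β i) * (X + C 1) ^ (α i) with hg₁_def
  have hcomp : g.comp (C (-1) * X + C (-1)) = g₁ := comp_neg_X_sub_one c α β
  -- the substitution is an involution, so `g₁ ≠ 0`
  have hinv : (C (-1) * X + C (-1) : K[X]).comp (C (-1) * X + C (-1)) = X := by
    rw [show (C (-1) : K[X]) = -1 by simp]
    simp only [add_comp, mul_comp, neg_comp, one_comp, X_comp]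
    ring
  have hg₁ : g₁ ≠ 0 := by
    intro h0
    apply hg
    have : g = g₁.comp (C (-1) * X + C (-1)) := by rw [← hcomp, comp_assoc, hinv, comp_X]
    rw [this, h0, zero_comp]
  have h1 := countP_roots_pos_le (fun i => c i * (-1) ^ (α i + β i)) β α hg₁
  -- transport the count along `x ↦ −1 − x`
  have hroots : g₁.roots = g.roots.map (fun x => -1 - x) := by
    rw [← hcomp, roots_comp_C_mul_X_add_C g (-1) (-1) isUnit_one.neg, Ring.inverse_eq_inv]
    refine Multiset.map_congr rfl fun x _ => ?_
    field_simp
    ring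
  have hcount : g₁.roots.countP (fun x => 0 < x) = g.roots.countP (fun x => x < -1) := by
    rw [hroots, Multiset.countP_map, Multiset.countP_eq_card_filter]
    congr 1
    exact Multiset.filter_congr fun x _ => by constructor <;> intro h <;> linarith
  rw [← hcount]
  exact h1

omit [LinearOrder K] [IsStrictOrderedRing K] [Fintype ι] in
/-- `reflect N` is additive over finite sums. [folklore] -/
private theorem reflect_finset_sum (s : Finset ι) (f : ι → K[X]) (N : ℕ) :
    (∑ i ∈ s, f i).reflect N = ∑ i ∈ s, (f i).reflect N := by
  classical
  induction s using Finset.induction_on with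
  | empty => simp [reflect_zero]
  | insert a s ha ih => rw [Finset.sum_insert ha, Finset.sum_insert ha, reflect_add, ih]

/-- Reflection: `x^D g(1/x) = Σᵢ cᵢ x^{D−αᵢ−βᵢ} (x+1)^{βᵢ}` for `D ≥ αᵢ + βᵢ` — again of the same
shape (used here in place of the printed `f₂(x, x+1) = (x+1)^{deg g} g(−x/(x+1))`).
[cite: Avendano2009, Thm. 1 (proof, p.1283 L25–29: the polynomial f₂, reflected variant)] -/
theorem reflect_eq {D : ℕ} (hD : ∀ i, α i + β i ≤ D) :
    (∑ i, C (c i) * X ^ (α i) * (X + C 1) ^ (β i)).reflect D =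
      ∑ i, C (c i) * X ^ (D - (α i + β i)) * (X + C 1) ^ (β i) := by
  have hXd : ∀ n : ℕ, ((X + C 1 : K[X]) ^ n).natDegree ≤ n := fun n => by
    rw [natDegree_pow, natDegree_X_add_C, mul_one]
  have hXpow : ∀ n : ℕ, ((X : K[X]) ^ n).natDegree ≤ n := fun n => by rw [natDegree_X_pow]
  have hX11 : (X + C 1 : K[X]).reflect 1 = X + C 1 := by
    ext k
    rw [coeff_reflect]
    rcases k with _ | _ | k
    · simp [revAt_le, coeff_one]
    · simp [revAt_le, coeff_one]
    · have hk : ¬ (k + 2 ≤ 1) := by omega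
      simp [revAt, hk, coeff_X, coeff_one]
  have hX1 : ∀ n : ℕ, ((X + C 1 : K[X]) ^ n).reflect n = (X + C 1) ^ n := by
    intro n
    induction n with
    | zero => simp
    | succ n ih =>
      rw [pow_succ, reflect_mul _ _ (F := n) (G := 1) (hXd n) (natDegree_X_add_C (1 : K)).le, ih,
        hX11]
  have hterm : ∀ i, (C (c i) * X ^ (α i) * (X + C 1) ^ (β i)).reflect D =
      C (c i) * X ^ (D - (α i + β i)) * (X + C 1) ^ (β i) := by
    intro i
    obtain ⟨e, he⟩ := Nat.exists_eq_add_of_le (hD i)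
    have h1 : (C (c i) * X ^ (α i) * (X + C 1) ^ (β i) : K[X]) =
        C (c i) * ((X ^ (α i) * (X + C 1) ^ (β i)) * 1) := by ring
    have hprod : (X ^ (α i) * (X + C 1) ^ (β i) : K[X]).natDegree ≤ α i + β i :=
      natDegree_mul_le.trans (Nat.add_le_add (hXpow _) (hXd _))
    rw [h1, reflect_C_mul, he, Nat.add_sub_cancel_left,
      reflect_mul _ _ (F := α i + β i) (G := e) hprod (by simp), reflect_one,
      reflect_mul _ _ (F := α i) (G := β i) (hXpow _) (hXd _), hX1,
      reflect_monomial, revAt_le le_rfl, Nat.sub_self, pow_zero, one_mul]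
    ring
  rw [reflect_finset_sum, Finset.sum_congr rfl fun i _ => hterm i]

omit [Fintype ι] in
/-- `1/y < −1 ⟺ −1 < y < 0` (`y ≠ 0`). [folklore] -/
private theorem inv_lt_neg_one_iff {y : K} (hy : y ≠ 0) : y⁻¹ < -1 ↔ -1 < y ∧ y < 0 := by
  constructor
  · intro h
    have hyneg : y < 0 := by
      by_contra hcon
      have : 0 < y := lt_of_le_of_ne (not_lt.mp hcon) (Ne.symm hy)
      have : 0 < y⁻¹ := inv_pos.mpr this
      linarith
    refine ⟨?_, hyneg⟩
    have h1 : y * y⁻¹ = 1 := mul_inv_cancel₀ hy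
    nlinarith
  · rintro ⟨h1, h2⟩
    have h3 : y * y⁻¹ = 1 := mul_inv_cancel₀ h2.ne
    have h4 : y⁻¹ < 0 := inv_lt_zero.mpr h2
    nlinarith

/-- Roots in `(−1, 0)`, with multiplicity, number at most `2t − 2`: `x ↦ 1/x` maps them onto the
roots in `(−∞, −1)` of the reflected polynomial `x^D g(1/x) = Σᵢ cᵢ x^{D−αᵢ−βᵢ} (x+1)^{βᵢ}`, which
has the same shape (the print uses `(x+1)^{deg g} g(−x/(x+1))`; reflecting instead avoids the
Möbius change of variable and the tacit assumption `deg g ≥ αᵢ + βᵢ`).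
[cite: Avendano2009, Thm. 1 (proof, roots in (−1, 0))] -/
theorem countP_roots_Ioo_le
    (hg : ∑ i, C (c i) * X ^ (α i) * (X + C 1) ^ (β i) ≠ 0) :
    (∑ i, C (c i) * X ^ (α i) * (X + C 1) ^ (β i)).roots.countP (fun x => -1 < x ∧ x < 0) + 2 ≤
      2 * Fintype.card ι := by
  classical
  set g := ∑ i, C (c i) * X ^ (α i) * (X + C 1) ^ (β i) with hg_def
  set D := ∑ i, (α i + β i) with hD_def
  have hD : ∀ i, α i + β i ≤ D := fun i =>
    Finset.single_le_sum (f := fun i => α i + β i) (fun _ _ => Nat.zero_le _) (Finset.mem_univ i)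
  set h := ∑ i, C (c i) * X ^ (D - (α i + β i)) * (X + C 1) ^ (β i) with hh_def
  have hrefl : g.reflect D = h := reflect_eq c α β hD
  have hgdeg : g.natDegree ≤ D := by
    refine natDegree_sum_le_of_forall_le _ _ fun i _ => ?_
    calc (C (c i) * X ^ (α i) * (X + C 1) ^ (β i) : K[X]).natDegree
        ≤ (C (c i) * X ^ (α i) : K[X]).natDegree + ((X + C 1 : K[X]) ^ (β i)).natDegree :=
          natDegree_mul_le
      _ ≤ α i + β i := Nat.add_le_add (natDegree_C_mul_X_pow_le _ _)
          (by rw [natDegree_pow, natDegree_X_add_C, mul_one])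
      _ ≤ D := hD i
  obtain ⟨e, he⟩ := Nat.exists_eq_add_of_le hgdeg
  have hrev : g.reflect D = g.reverse * X ^ e := by
    have := reflect_mul g 1 (F := g.natDegree) (G := e) le_rfl (by simp)
    rwa [mul_one, reflect_one, ← he] at this
  have hh0 : h ≠ 0 := by
    rw [← hrefl, hrev]
    exact mul_ne_zero (fun h0 => hg (reverse_eq_zero.mp h0)) (pow_ne_zero _ X_ne_zero)
  have h1 := countP_roots_lt_neg_one_le c (fun i => D - (α i + β i)) β hh0
  have hroots : h.roots = ((g.roots.filter (· ≠ 0)).map (·⁻¹)) + e • ({0} : Multiset K) := by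
    rw [← hrefl, hrev, roots_mul (hrev ▸ hrefl ▸ hh0),
      Literature.Algebra.Polynomial.Descartes.roots_reverse_of_ne_zero hg, roots_X_pow]
  have hcount : h.roots.countP (fun x => x < -1) = g.roots.countP (fun x => -1 < x ∧ x < 0) := by
    have h0 : Multiset.countP (fun x : K => x < -1) ({0} : Multiset K) = 0 :=
      Multiset.countP_eq_zero.mpr fun x hx => by
        rw [Multiset.mem_singleton] at hx; subst hx; norm_num
    rw [hroots, Multiset.countP_add, Multiset.countP_nsmul, h0, mul_zero, add_zero,
      Multiset.countP_map, Multiset.filter_filter, Multiset.countP_eq_card_filter]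
    congr 1
    refine Multiset.filter_congr fun x _ => ?_
    constructor
    · rintro ⟨hlt, hne⟩; exact (inv_lt_neg_one_iff hne).mp hlt
    · rintro ⟨h1', h2'⟩; exact ⟨(inv_lt_neg_one_iff h2'.ne).mpr ⟨h1', h2'⟩, h2'.ne⟩
  rw [← hcount]
  exact h1

omit [Fintype ι] in
/-- Splitting a count of the roots off `{0, −1}` into the three open intervals. [folklore] -/
private theorem countP_split (m : Multiset K) :
    m.countP (fun x => x ≠ 0 ∧ x ≠ -1) =
      m.countP (fun x => x < -1) + m.countP (fun x => -1 < x ∧ x < 0) +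
        m.countP (fun x => 0 < x) := by
  induction m using Multiset.induction_on with
  | empty => simp
  | cons a m ih =>
    simp only [Multiset.countP_cons, ih]
    have key : (if a ≠ 0 ∧ a ≠ -1 then 1 else 0 : ℕ) =
        (if a < -1 then 1 else 0) + (if -1 < a ∧ a < 0 then 1 else 0) +
          (if 0 < a then 1 else 0) := by
      rcases lt_trichotomy a (-1) with h | h | h
      · have h1 : ¬ (-1 < a ∧ a < 0) := fun hh => by linarith [hh.1]
        have h2 : ¬ (0 < a) := fun hh => by linarith
        have h3 : a ≠ 0 ∧ a ≠ -1 := ⟨by intro h0; linarith, ne_of_lt h⟩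
        simp [h, h1, h2, h3]
      · subst h; simp
      · rcases lt_trichotomy a 0 with h' | h' | h'
        · have h1 : ¬ (a < -1) := fun hh => by linarith
          have h2 : ¬ (0 < a) := fun hh => by linarith
          have h3 : a ≠ 0 ∧ a ≠ -1 := ⟨ne_of_lt h', ne_of_gt h⟩
          simp [h1, h2, h3, h, h']
        · subst h'; simp
        · have h1 : ¬ (a < -1) := fun hh => by linarith
          have h2 : ¬ (-1 < a ∧ a < 0) := fun hh => by linarith [hh.2]
          have h3 : a ≠ 0 ∧ a ≠ -1 := ⟨ne_of_gt h', by intro h0; linarith⟩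
          simp [h1, h2, h3, h']
    omega

/-- **Theorem 1 on the line `y = x + 1`**: for `g = f(x, x+1) = Σᵢ cᵢ x^{αᵢ} (x+1)^{βᵢ} ≠ 0`,
the number of real roots counted with multiplicities, except that `0` and `−1` are counted at most
once, is at most `6t − 4` (written `… + 4 ≤ 6t`). [cite: Avendano2009, Thm. 1 (case a = b = 1)] -/
theorem line_one_one (hg : ∑ i, C (c i) * X ^ (α i) * (X + C 1) ^ (β i) ≠ 0) :
    (∑ i, C (c i) * X ^ (α i) * (X + C 1) ^ (β i)).roots.countP (fun x => x ≠ 0 ∧ x ≠ -1) +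
      (if (∑ i, C (c i) * X ^ (α i) * (X + C 1) ^ (β i)).IsRoot 0 then 1 else 0) +
      (if (∑ i, C (c i) * X ^ (α i) * (X + C 1) ^ (β i)).IsRoot (-1) then 1 else 0) + 4 ≤
      6 * Fintype.card ι := by
  have h1 := countP_roots_pos_le c α β hg
  have h2 := countP_roots_lt_neg_one_le c α β hg
  have h3 := countP_roots_Ioo_le c α β hg
  rw [countP_split]
  have i1 := ite_le_one ((∑ i, C (c i) * X ^ (α i) * (X + C 1) ^ (β i)).IsRoot 0)
  have i2 := ite_le_one ((∑ i, C (c i) * X ^ (α i) * (X + C 1) ^ (β i)).IsRoot (-1))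
  omega

end LineOneOne

/-! ## Theorem 1 on a general line `y = a x + b` -/

section GeneralLine

variable {K : Type*} [Field K] [LinearOrder K] [IsStrictOrderedRing K]
variable {ι : Type*} [Fintype ι] (c : ι → K) (α β : ι → ℕ) (a b : K)

omit [LinearOrder K] [IsStrictOrderedRing K] in
/-- The rescaling `x ↦ (b/a) x` (for `a, b ≠ 0`): `g((b/a) x) = f((b/a)x, b(x+1)) =
Σᵢ cᵢ (b/a)^{αᵢ} b^{βᵢ} x^{αᵢ} (x+1)^{βᵢ}` — the printed reduction to `a = b = 1`.
[cite: Avendano2009, Thm. 1 (proof, the polynomial f̂)] -/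
theorem comp_C_mul_X_line (ha : a ≠ 0) :
    (∑ i, C (c i) * X ^ (α i) * (C a * X + C b) ^ (β i)).comp (C (b / a) * X) =
      ∑ i, C (c i * (b / a) ^ (α i) * b ^ (β i)) * X ^ (α i) * (X + C 1) ^ (β i) := by
  rw [Polynomial.sum_comp]
  refine Finset.sum_congr rfl fun i _ => ?_
  simp only [mul_comp, C_comp, pow_comp, X_comp, add_comp]
  have hab : a * (b / a) = b := by field_simp
  have h1 : (C a * (C (b / a) * X) + C b : K[X]) = C b * (X + C 1) := by
    rw [← mul_assoc, ← C_mul, hab, mul_add, ← C_mul, mul_one]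
  rw [h1, mul_pow, mul_pow, ← C_pow, ← C_pow, C_mul, C_mul]
  ring

omit [LinearOrder K] [IsStrictOrderedRing K] [Fintype ι] in
/-- `g(s x) = 0 ⟺ g = 0` for `s ≠ 0`. [folklore] -/
private theorem comp_C_mul_X_eq_zero_iff {s : K} (hs : s ≠ 0) (g : K[X]) :
    g.comp (C s * X) = 0 ↔ g = 0 := by
  constructor
  · intro h
    have hinv : (C s * X : K[X]).comp (C s⁻¹ * X) = X := by
      rw [mul_comp, C_comp, X_comp, ← mul_assoc, ← C_mul, mul_inv_cancel₀ hs, C_1, one_mul]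
    rw [← comp_X (p := g), ← hinv, ← comp_assoc, h, zero_comp]
  · intro h; rw [h, zero_comp]

omit [Fintype ι] in
/-- Descartes' rule with multiplicity, sparse form: positive roots (with multiplicity) of a nonzero
polynomial are fewer than its monomials. [folklore] -/
private theorem countP_roots_pos_lt_card_support {P : K[X]} (hP : P ≠ 0) :
    P.roots.countP (fun x => 0 < x) < P.support.card :=
  (roots_countP_pos_le_signVariations P).trans_lt
    (Literature.Computability.AlgebraicComplexity.signVariations_lt_card_support hP)

omit [Fintype ι] in
/-- … and so are the negative roots (apply the previous bound to `P(−x)`). [folklore] -/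
private theorem countP_roots_neg_lt_card_support {P : K[X]} (hP : P ≠ 0) :
    P.roots.countP (fun x => x < 0) < P.support.card := by
  have hQ : P.comp (-X) ≠ 0 := fun h => hP (comp_neg_X_eq_zero_iff.mp h)
  have h1 := countP_roots_pos_lt_card_support hQ
  rw [Literature.Computability.AlgebraicComplexity.support_comp_neg_X, roots_comp_neg_X,
    Multiset.countP_map] at h1
  have hf : P.roots.filter (fun x => x < 0) = P.roots.filter (fun x => 0 < -x) :=
    Multiset.filter_congr fun x _ => by constructor <;> intro h <;> linarith
  rw [Multiset.countP_eq_card_filter, hf]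
  exact h1

omit [LinearOrder K] [IsStrictOrderedRing K] in
/-- On the lines through the origin or horizontal lines the restriction is a `t`-sparse univariate
polynomial: `Σᵢ dᵢ x^{γᵢ}` has at most `#ι` monomials. [folklore] -/
private theorem card_support_sum_C_mul_X_pow_le (d : ι → K) (γ : ι → ℕ) :
    (∑ i, C (d i) * X ^ (γ i)).support.card ≤ Fintype.card ι := by
  classical
  refine (Literature.Computability.AlgebraicComplexity.card_support_sum_le _ _).trans ?_
  have h1 : ∀ i, (C (d i) * X ^ (γ i)).support.card ≤ 1 := fun i =>
    card_support_C_mul_X_pow_le_one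
  calc ∑ i, (C (d i) * X ^ (γ i)).support.card ≤ ∑ _i : ι, 1 :=
        Finset.sum_le_sum (f := fun i => (C (d i) * X ^ (γ i)).support.card) (g := fun _ => 1)
          fun i _ => h1 i
    _ = Fintype.card ι := by simp

/-- The sparse univariate case (used for `a = 0` or `b = 0`): a nonzero `Σᵢ cᵢ dᵢ x^{γᵢ}` has at most
`2t − 2` nonzero roots counted with multiplicity, plus possibly the root `0`:
"either `g ≡ 0` or `g` has at most `2t − 1` real roots (counted with multiplicities except for the
possible root `0`)". [cite: Avendano2009, Thm. 1 (proof, case a = 0 or b = 0)] -/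
theorem sparse_case (d : ι → K) (γ : ι → ℕ) (hg : ∑ i, C (d i) * X ^ (γ i) ≠ 0) :
    (∑ i, C (d i) * X ^ (γ i)).roots.countP (fun x => x ≠ 0) + 2 ≤ 2 * Fintype.card ι := by
  set g := ∑ i, C (d i) * X ^ (γ i) with hg_def
  have hsplit : g.roots.countP (fun x => x ≠ 0) =
      g.roots.countP (fun x => x < 0) + g.roots.countP (fun x => 0 < x) := by
    induction g.roots using Multiset.induction_on with
    | empty => simp
    | cons r m ih =>
      simp only [Multiset.countP_cons, ih]
      rcases lt_trichotomy r 0 with h | h | h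
      · have h2 : ¬ (0 < r) := fun hh => by linarith
        simp [h, h2, h.ne]
        omega
      · subst h; simp
      · have h2 : ¬ (r < 0) := fun hh => by linarith
        simp [h, h2, h.ne']
        omega
  have h1 := countP_roots_pos_lt_card_support hg
  have h2 := countP_roots_neg_lt_card_support hg
  have h3 : g.support.card ≤ Fintype.card ι := card_support_sum_C_mul_X_pow_le d γ
  rw [hsplit]
  omega

/-- **Avendaño 2009, Theorem 1** (p. 1281), main clause: "Let `f = Σᵢ₌₁ᵗ aᵢ x^{αᵢ} y^{βᵢ} ∈ ℝ[x, y]`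
be a polynomial with at most `t` non-zero terms, and let `a, b ∈ ℝ`. Set `g(x) = f(x, ax + b)`.
Then either `g ≡ 0` or `g` has at most `6t − 4` real roots, counted with multiplicities except for
the possible roots `0` and `−b/a` that are counted at most once."
Typing: the `t` terms are an explicitly indexed family `cᵢ x^{αᵢ} y^{βᵢ}`, `i ∈ ι`, `t = #ι`
(coincident exponent pairs or zero coefficients only lower the true number of terms, and the bound
is monotone in `t`); `g = Σᵢ cᵢ x^{αᵢ} (a x + b)^{βᵢ}`; the count is
`#{roots ∉ {0, −b/a}, with multiplicity} + [g(0) = 0] + [g(−b/a) = 0]`; binder `a ≠ 0` explicit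
(the printed `−b/a` needs it; `a = 0` is `thm_1_of_a_eq_zero`). Any linearly ordered field.
Context: the tree's `KoiranPortierTavenas2015.KPT2015_cor_14` bounds the roots of this family on the
single sign cell `{x > 0, ax + b > 0}` by `2t³/3 + 5t` (real exponents, Wronskians); Avendaño's
bound is LINEAR, `2t − 2` per cell with multiplicity (`thm_1_moreover_pos/neg`), integer exponents,
by Descartes' rule and Lemma 5. Later sharpened to `6t − 7` for `t ≥ 3` (Bihan–El Hilany 2017,
arXiv:1506.03309; typed in `SparseCurveLineSharpBound`, `BihanElHilany2017.thm_1`).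
[cite: Avendano2009, Thm. 1, doi:10.1016/j.jsc.2008.02.016 p.1281 L17–23; proof p.1283 L5–30] -/
theorem thm_1 (ha : a ≠ 0) :
    (∑ i, C (c i) * X ^ (α i) * (C a * X + C b) ^ (β i)) = 0 ∨
      (∑ i, C (c i) * X ^ (α i) * (C a * X + C b) ^ (β i)).roots.countP
          (fun x => x ≠ 0 ∧ x ≠ -b / a) +
        (if (∑ i, C (c i) * X ^ (α i) * (C a * X + C b) ^ (β i)).IsRoot 0 then 1 else 0) +
        (if (∑ i, C (c i) * X ^ (α i) * (C a * X + C b) ^ (β i)).IsRoot (-b / a) then 1 else 0)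
        ≤ 6 * Fintype.card ι - 4 := by
  classical
  set g := ∑ i, C (c i) * X ^ (α i) * (C a * X + C b) ^ (β i) with hg_def
  by_cases hg : g = 0
  · exact Or.inl hg
  right
  have hι : 0 < Fintype.card ι := by
    rw [Fintype.card_pos_iff]; by_contra hι
    rw [not_nonempty_iff] at hι
    exact hg (by rw [hg_def]; exact Fintype.sum_empty _)
  have i1 := ite_le_one (g.IsRoot 0)
  have i2 := ite_le_one (g.IsRoot (-b / a))
  by_cases hb : b = 0
  · -- `b = 0`: `g = Σ cᵢ a^{βᵢ} x^{αᵢ + βᵢ}` is `t`-sparse and `−b/a = 0`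
    have hb0 : -b / a = 0 := by rw [hb, neg_zero, zero_div]
    have hgs : g = ∑ i, C (c i * a ^ (β i)) * X ^ (α i + β i) := by
      rw [hg_def]
      refine Finset.sum_congr rfl fun i _ => ?_
      rw [hb, C_0, add_zero, mul_pow, ← C_pow, C_mul, pow_add]; ring
    have hs := sparse_case (fun i => c i * a ^ (β i)) (fun i => α i + β i) (hgs ▸ hg)
    rw [← hgs] at hs
    have hc : g.roots.countP (fun x => x ≠ 0 ∧ x ≠ -b / a) = g.roots.countP (fun x => x ≠ 0) := by
      rw [hb0]; exact Multiset.countP_congr rfl fun x _ => by simp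
    rw [hc]
    omega
  · -- `a, b ≠ 0`: rescale to the line `y = x + 1`
    set s := b / a with hs_def
    have hs : s ≠ 0 := div_ne_zero hb ha
    set ĝ := ∑ i, C (c i * s ^ (α i) * b ^ (β i)) * X ^ (α i) * (X + C 1) ^ (β i) with hĝ_def
    have hcomp : g.comp (C s * X) = ĝ := comp_C_mul_X_line c α β a b ha
    have hĝ : ĝ ≠ 0 := by rw [← hcomp]; exact fun h => hg ((comp_C_mul_X_eq_zero_iff hs g).mp h)
    have h11 := line_one_one (fun i => c i * s ^ (α i) * b ^ (β i)) α β hĝ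
    have hroots : ĝ.roots = g.roots.map (fun x => s⁻¹ * x) := by
      rw [← hcomp, show (C s * X : K[X]) = C s * X + C 0 by rw [C_0, add_zero],
        roots_comp_C_mul_X_add_C g s 0 (isUnit_iff_ne_zero.mpr hs), Ring.inverse_eq_inv]
      simp
    have hba : -b / a = -s := by rw [hs_def, neg_div]
    have hcount : ĝ.roots.countP (fun x => x ≠ 0 ∧ x ≠ -1) =
        g.roots.countP (fun x => x ≠ 0 ∧ x ≠ -b / a) := by
      rw [hroots, Multiset.countP_map, Multiset.countP_eq_card_filter, hba]
      congr 1
      refine Multiset.filter_congr fun x _ => ?_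
      have e1 : s⁻¹ * x = 0 ↔ x = 0 := by
        rw [mul_eq_zero, or_iff_right (inv_ne_zero hs)]
      have e2 : s⁻¹ * x = -1 ↔ x = -s := by
        constructor
        · intro h; have := congr_arg (s * ·) h; simp [hs] at this; linarith
        · intro h; rw [h, mul_neg, inv_mul_cancel₀ hs]
      rw [Ne, e1, Ne, e2]
    have hr0 : ĝ.IsRoot 0 ↔ g.IsRoot 0 := by
      rw [← hcomp, IsRoot, eval_comp]; simp [IsRoot]
    have hr1 : ĝ.IsRoot (-1) ↔ g.IsRoot (-b / a) := by
      rw [← hcomp, IsRoot, eval_comp, hba]; simp [IsRoot]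
    rw [hcount, if_congr hr0 rfl rfl, if_congr hr1 rfl rfl] at h11
    omega

/-- Theorem 1 for `a = 0` (the binder `a ≠ 0` of `thm_1` removed, as a remark: on a horizontal
line `g = f(x, b) = Σᵢ cᵢ b^{βᵢ} x^{αᵢ}` is `t`-sparse, so "Descartes' rule of signs implies that
either `g ≡ 0` or `g` has at most `2t − 1 ≤ 6t − 4` real roots (counted with multiplicities except
for the possible root `0`)" — the first sentence of the printed proof).
[cite: Avendano2009, Thm. 1 (proof, case a = 0)] -/
theorem thm_1_of_a_eq_zero :
    (∑ i, C (c i) * X ^ (α i) * (C 0 * X + C b) ^ (β i)) = 0 ∨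
      (∑ i, C (c i) * X ^ (α i) * (C 0 * X + C b) ^ (β i)).roots.countP (fun x => x ≠ 0) +
        (if (∑ i, C (c i) * X ^ (α i) * (C 0 * X + C b) ^ (β i)).IsRoot 0 then 1 else 0)
        ≤ 2 * Fintype.card ι - 1 := by
  set g := ∑ i, C (c i) * X ^ (α i) * (C 0 * X + C b) ^ (β i) with hg_def
  by_cases hg : g = 0
  · exact Or.inl hg
  right
  have hgs : g = ∑ i, C (c i * b ^ (β i)) * X ^ (α i) := by
    rw [hg_def]
    refine Finset.sum_congr rfl fun i _ => ?_
    rw [C_0, zero_mul, zero_add, ← C_pow, C_mul]; ring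
  have hs := sparse_case (fun i => c i * b ^ (β i)) α (hgs ▸ hg)
  rw [← hgs] at hs
  have i1 := ite_le_one (g.IsRoot 0)
  omega

/-- **Avendaño 2009, Theorem 1**, the "Moreover" clause for `b/a > 0`: if `g ≢ 0` then `g` has at
most `2t − 2` real roots counted with multiplicities in each of the three intervals `(−∞, −b/a)`,
`(−b/a, 0)` and `(0, +∞)` (written `count + 2 ≤ 2t`). [cite: Avendano2009, Thm. 1 ("Moreover", b/a > 0), doi:10.1016/j.jsc.2008.02.016 p.1281 L21–23] -/
theorem thm_1_moreover_pos (hab : 0 < b / a)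
    (hg : ∑ i, C (c i) * X ^ (α i) * (C a * X + C b) ^ (β i) ≠ 0) :
    (∑ i, C (c i) * X ^ (α i) * (C a * X + C b) ^ (β i)).roots.countP
        (fun x => x < -b / a) + 2 ≤ 2 * Fintype.card ι ∧
    (∑ i, C (c i) * X ^ (α i) * (C a * X + C b) ^ (β i)).roots.countP
        (fun x => -b / a < x ∧ x < 0) + 2 ≤ 2 * Fintype.card ι ∧
    (∑ i, C (c i) * X ^ (α i) * (C a * X + C b) ^ (β i)).roots.countP
        (fun x => 0 < x) + 2 ≤ 2 * Fintype.card ι := by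
  classical
  set g := ∑ i, C (c i) * X ^ (α i) * (C a * X + C b) ^ (β i) with hg_def
  set s := b / a with hs_def
  have hs : s ≠ 0 := hab.ne'
  have ha : a ≠ 0 := by rintro rfl; simp [hs_def] at hab
  have hb : b ≠ 0 := by rintro rfl; simp [hs_def] at hab
  set ĝ := ∑ i, C (c i * s ^ (α i) * b ^ (β i)) * X ^ (α i) * (X + C 1) ^ (β i) with hĝ_def
  have hcomp : g.comp (C s * X) = ĝ := comp_C_mul_X_line c α β a b ha
  have hĝ : ĝ ≠ 0 := by rw [← hcomp]; exact fun h => hg ((comp_C_mul_X_eq_zero_iff hs g).mp h)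
  have hroots : ĝ.roots = g.roots.map (fun x => s⁻¹ * x) := by
    rw [← hcomp, show (C s * X : K[X]) = C s * X + C 0 by rw [C_0, add_zero],
      roots_comp_C_mul_X_add_C g s 0 (isUnit_iff_ne_zero.mpr hs), Ring.inverse_eq_inv]
    simp
  have hba : -b / a = -s := by rw [hs_def, neg_div]
  have key : ∀ (P Q : K → Prop) [DecidablePred P] [DecidablePred Q],
      (∀ x, P (s⁻¹ * x) ↔ Q x) → ĝ.roots.countP P = g.roots.countP Q := by
    intro P Q _ _ hPQ
    rw [hroots, Multiset.countP_map, Multiset.countP_eq_card_filter]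
    congr 1
    exact Multiset.filter_congr fun x _ => hPQ x
  have e1 : ∀ x, s⁻¹ * x < -1 ↔ x < -b / a := fun x => by
    rw [inv_mul_lt_iff₀ hab, hba, mul_neg_one]
  have e2 : ∀ x, (-1 < s⁻¹ * x ∧ s⁻¹ * x < 0) ↔ (-b / a < x ∧ x < 0) := fun x => by
    rw [lt_inv_mul_iff₀ hab, inv_mul_lt_iff₀ hab, hba, mul_neg_one, mul_zero]
  have e3 : ∀ x, 0 < s⁻¹ * x ↔ 0 < x := fun x => by
    rw [lt_inv_mul_iff₀ hab, mul_zero]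
  refine ⟨?_, ?_, ?_⟩
  · have h := countP_roots_lt_neg_one_le (fun i => c i * s ^ (α i) * b ^ (β i)) α β hĝ
    rwa [key (fun x => x < -1) (fun x => x < -b / a) e1] at h
  · have h := countP_roots_Ioo_le (fun i => c i * s ^ (α i) * b ^ (β i)) α β hĝ
    rwa [key (fun x => -1 < x ∧ x < 0) (fun x => -b / a < x ∧ x < 0) e2] at h
  · have h := countP_roots_pos_le (fun i => c i * s ^ (α i) * b ^ (β i)) α β hĝ
    rwa [key (fun x => 0 < x) (fun x => 0 < x) e3] at h

/-- **Avendaño 2009, Theorem 1**, the "Moreover" clause for `b/a < 0`: if `g ≢ 0` then `g` has at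
most `2t − 2` real roots counted with multiplicities in each of the three intervals `(−∞, 0)`,
`(0, −b/a)` and `(−b/a, +∞)`. [cite: Avendano2009, Thm. 1 ("Moreover", b/a < 0), doi:10.1016/j.jsc.2008.02.016 p.1281 L21–23] -/
theorem thm_1_moreover_neg (hab : b / a < 0)
    (hg : ∑ i, C (c i) * X ^ (α i) * (C a * X + C b) ^ (β i) ≠ 0) :
    (∑ i, C (c i) * X ^ (α i) * (C a * X + C b) ^ (β i)).roots.countP
        (fun x => x < 0) + 2 ≤ 2 * Fintype.card ι ∧
    (∑ i, C (c i) * X ^ (α i) * (C a * X + C b) ^ (β i)).roots.countP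
        (fun x => 0 < x ∧ x < -b / a) + 2 ≤ 2 * Fintype.card ι ∧
    (∑ i, C (c i) * X ^ (α i) * (C a * X + C b) ^ (β i)).roots.countP
        (fun x => -b / a < x) + 2 ≤ 2 * Fintype.card ι := by
  classical
  set g := ∑ i, C (c i) * X ^ (α i) * (C a * X + C b) ^ (β i) with hg_def
  set s := b / a with hs_def
  have hs : s ≠ 0 := hab.ne
  have ha : a ≠ 0 := by rintro rfl; simp [hs_def] at hab
  have hb : b ≠ 0 := by rintro rfl; simp [hs_def] at hab
  set ĝ := ∑ i, C (c i * s ^ (α i) * b ^ (β i)) * X ^ (α i) * (X + C 1) ^ (β i) with hĝ_def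
  have hcomp : g.comp (C s * X) = ĝ := comp_C_mul_X_line c α β a b ha
  have hĝ : ĝ ≠ 0 := by rw [← hcomp]; exact fun h => hg ((comp_C_mul_X_eq_zero_iff hs g).mp h)
  have hroots : ĝ.roots = g.roots.map (fun x => s⁻¹ * x) := by
    rw [← hcomp, show (C s * X : K[X]) = C s * X + C 0 by rw [C_0, add_zero],
      roots_comp_C_mul_X_add_C g s 0 (isUnit_iff_ne_zero.mpr hs), Ring.inverse_eq_inv]
    simp
  have hba : -b / a = -s := by rw [hs_def, neg_div]
  have key : ∀ (P Q : K → Prop) [DecidablePred P] [DecidablePred Q],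
      (∀ x, P (s⁻¹ * x) ↔ Q x) → ĝ.roots.countP P = g.roots.countP Q := by
    intro P Q _ _ hPQ
    rw [hroots, Multiset.countP_map, Multiset.countP_eq_card_filter]
    congr 1
    exact Multiset.filter_congr fun x _ => hPQ x
  have hu : 0 < -s := neg_pos.mpr hab
  have hsx : ∀ x, s⁻¹ * x = (-s)⁻¹ * (-x) := fun x => by rw [inv_neg, neg_mul_neg]
  have e1 : ∀ x, 0 < s⁻¹ * x ↔ x < 0 := fun x => by
    rw [hsx, lt_inv_mul_iff₀ hu, mul_zero, neg_pos]
  have e2 : ∀ x, (-1 < s⁻¹ * x ∧ s⁻¹ * x < 0) ↔ (0 < x ∧ x < -b / a) := fun x => by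
    rw [hsx, lt_inv_mul_iff₀ hu, inv_mul_lt_iff₀ hu, hba, mul_neg_one, neg_neg, mul_zero,
      neg_lt_zero]
    constructor
    · rintro ⟨h1, h2⟩; exact ⟨h2, by linarith⟩
    · rintro ⟨h1, h2⟩; exact ⟨by linarith, h1⟩
  have e3 : ∀ x, s⁻¹ * x < -1 ↔ -b / a < x := fun x => by
    rw [hsx, inv_mul_lt_iff₀ hu, hba, mul_neg_one, neg_neg, neg_lt]
  refine ⟨?_, ?_, ?_⟩
  · have h := countP_roots_pos_le (fun i => c i * s ^ (α i) * b ^ (β i)) α β hĝ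
    rwa [key (fun x => 0 < x) (fun x => x < 0) e1] at h
  · have h := countP_roots_Ioo_le (fun i => c i * s ^ (α i) * b ^ (β i)) α β hĝ
    rwa [key (fun x => -1 < x ∧ x < 0) (fun x => 0 < x ∧ x < -b / a) e2] at h
  · have h := countP_roots_lt_neg_one_le (fun i => c i * s ^ (α i) * b ^ (β i)) α β hĝ
    rwa [key (fun x => x < -1) (fun x => -b / a < x) e3] at h

omit [Field K] [LinearOrder K] [IsStrictOrderedRing K] [Fintype ι] in
/-- Distinct elements of a multiset versus a count with multiplicity off two marked points.
[folklore] -/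
private theorem card_toFinset_le_countP_add [DecidableEq K] (m : Multiset K) (e₁ e₂ : K) :
    m.toFinset.card ≤ m.countP (fun x => x ≠ e₁ ∧ x ≠ e₂) +
      (if e₁ ∈ m then 1 else 0) + (if e₂ ∈ m then 1 else 0) := by
  rw [← Finset.card_filter_add_card_filter_not (fun x => x ≠ e₁ ∧ x ≠ e₂)]
  have h1 : (m.toFinset.filter (fun x => x ≠ e₁ ∧ x ≠ e₂)).card ≤
      m.countP (fun x => x ≠ e₁ ∧ x ≠ e₂) := by
    rw [← Multiset.toFinset_filter, Multiset.countP_eq_card_filter]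
    exact Multiset.toFinset_card_le _
  have h2 : (m.toFinset.filter (fun x => ¬ (x ≠ e₁ ∧ x ≠ e₂))).card ≤
      (if e₁ ∈ m then 1 else 0) + (if e₂ ∈ m then 1 else 0) := by
    have hsub : m.toFinset.filter (fun x => ¬ (x ≠ e₁ ∧ x ≠ e₂)) ⊆
        m.toFinset.filter (fun x => x = e₁) ∪ m.toFinset.filter (fun x => x = e₂) := by
      intro x hx
      rw [Finset.mem_filter] at hx
      rw [Finset.mem_union, Finset.mem_filter, Finset.mem_filter]
      by_cases hx1 : x = e₁
      · exact Or.inl ⟨hx.1, hx1⟩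
      · right; refine ⟨hx.1, ?_⟩
        by_contra hx2; exact hx.2 ⟨hx1, hx2⟩
    refine (Finset.card_le_card hsub).trans ((Finset.card_union_le _ _).trans ?_)
    rw [Finset.filter_eq', Finset.filter_eq']
    simp only [Multiset.mem_toFinset]
    split_ifs <;> simp
  omega

/-- **Theorem 1, distinct-roots form** (typed ⊊ printed: every real root counted once): on ANY line
`y = a x + b`, if `g = f(x, ax + b) ≢ 0` then `g` has at most `6t − 4` distinct real roots
(`a = 0` included: there `g` is `t`-sparse and has at most `2t − 1` of them).
[cite: Avendano2009, Thm. 1 (corollary: distinct roots)] -/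
theorem thm_1_card_roots_le
    (hg : ∑ i, C (c i) * X ^ (α i) * (C a * X + C b) ^ (β i) ≠ 0) :
    (∑ i, C (c i) * X ^ (α i) * (C a * X + C b) ^ (β i)).roots.toFinset.card ≤
      6 * Fintype.card ι - 4 := by
  classical
  set g := ∑ i, C (c i) * X ^ (α i) * (C a * X + C b) ^ (β i) with hg_def
  have hι : 0 < Fintype.card ι := by
    rw [Fintype.card_pos_iff]; by_contra hι
    rw [not_nonempty_iff] at hι
    exact hg (by rw [hg_def]; exact Fintype.sum_empty _)
  have hmem : ∀ e, (if e ∈ g.roots then 1 else 0) = (if g.IsRoot e then 1 else 0 : ℕ) :=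
    fun e => if_congr (mem_roots hg) rfl rfl
  by_cases ha : a = 0
  · subst ha
    rcases thm_1_of_a_eq_zero c α β b with h0 | h
    · exact absurd h0 hg
    rw [← hg_def] at h
    have hc := card_toFinset_le_countP_add g.roots 0 0
    rw [hmem] at hc
    have hcc : g.roots.countP (fun x => x ≠ 0 ∧ x ≠ 0) = g.roots.countP (fun x => x ≠ 0) :=
      Multiset.countP_congr rfl fun x _ => by simp
    rw [hcc] at hc
    have i1 := ite_le_one (g.IsRoot 0)
    omega
  · rcases thm_1 c α β a b ha with h0 | h
    · exact absurd h0 hg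
    rw [← hg_def] at h
    have hc := card_toFinset_le_countP_add g.roots 0 (-b / a)
    rw [hmem, hmem] at hc
    omega

end GeneralLine

/-! ## Theorem 1 for `f ∈ K[x][y]` given as a polynomial (the number of terms read off `f`) -/

section Bivariate

variable {K : Type*} [Field K] [LinearOrder K] [IsStrictOrderedRing K]

omit [LinearOrder K] [IsStrictOrderedRing K] in
/-- `f(x, q(x))` as the sum over the terms of `f ∈ K[x][y]` (indexed by the pairs
`(j, k)` with `y^j x^k` in the support): the printed "`f = Σᵢ₌₁ᵗ aᵢ x^{αᵢ} y^{βᵢ}`" read off a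
polynomial. [cite: Avendano2009, Thm. 1 (setting, p.1281 L17–18: f with t non-zero terms)] -/
theorem eval_eq_sum_terms (f : Polynomial (Polynomial K)) (q : K[X]) :
    f.eval q = ∑ i : (Σ j : f.support, ((f.coeff j).support)),
      C ((f.coeff i.1).coeff i.2) * X ^ (i.2 : ℕ) * q ^ (i.1 : ℕ) := by
  classical
  rw [eval_eq_sum, Polynomial.sum_def]
  rw [← Finset.sum_coe_sort f.support]
  rw [Fintype.sum_sigma]
  refine Finset.sum_congr rfl fun j _ => ?_
  conv_lhs => rw [(f.coeff (j : ℕ)).as_sum_support_C_mul_X_pow, Finset.sum_mul]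
  rw [← Finset.sum_coe_sort (f.coeff (j : ℕ)).support]

omit [LinearOrder K] [IsStrictOrderedRing K] in
/-- The index type of the terms of `f` has `t = Σⱼ #supp(aⱼ)` elements — the number of non-zero
terms of `f ∈ K[x][y]`. [cite: Avendano2009, Thm. 1 (setting, p.1281 L17–18: f with t non-zero terms)] -/
theorem card_terms (f : Polynomial (Polynomial K)) :
    Fintype.card (Σ j : f.support, ((f.coeff j).support)) =
      ∑ j ∈ f.support, (f.coeff j).support.card := by
  classical
  rw [Fintype.card_sigma, ← Finset.sum_coe_sort f.support]
  simp

/-- **Avendaño 2009, Theorem 1** for `f ∈ K[x][y]` with `t` non-zero terms, `t` read off `f`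
(`t = Σⱼ #supp aⱼ` for `f = Σⱼ aⱼ(x) yʲ`), distinct-roots form: `g = f(x, ax + b)` is `0` or has at
most `6t − 4` distinct roots in `K`. [cite: Avendano2009, Thm. 1] -/
theorem thm_1_card_roots_le_of_bivariate (f : Polynomial (Polynomial K)) (a b : K)
    (hg : f.eval (C a * X + C b) ≠ 0) :
    (f.eval (C a * X + C b)).roots.toFinset.card ≤
      6 * (∑ j ∈ f.support, (f.coeff j).support.card) - 4 := by
  classical
  rw [eval_eq_sum_terms] at hg ⊢
  rw [← card_terms]
  exact thm_1_card_roots_le (fun i : (Σ j : f.support, ((f.coeff j).support)) =>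
    (f.coeff i.1).coeff i.2) (fun i => (i.2 : ℕ)) (fun i => (i.1 : ℕ)) a b hg

/-- **Avendaño 2009, Theorem 1**, main clause, for `f ∈ K[x][y]` with `t` non-zero terms read off
`f` (`a ≠ 0`): `g = f(x, ax + b)` is `0`, or its roots off `{0, −b/a}` counted with multiplicity
plus `[g(0) = 0] + [g(−b/a) = 0]` number at most `6t − 4`.
[cite: Avendano2009, Thm. 1, doi:10.1016/j.jsc.2008.02.016 p.1281 L17–21] -/
theorem thm_1_of_bivariate (f : Polynomial (Polynomial K)) (a b : K) (ha : a ≠ 0) :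
    f.eval (C a * X + C b) = 0 ∨
      (f.eval (C a * X + C b)).roots.countP (fun x => x ≠ 0 ∧ x ≠ -b / a) +
        (if (f.eval (C a * X + C b)).IsRoot 0 then 1 else 0) +
        (if (f.eval (C a * X + C b)).IsRoot (-b / a) then 1 else 0)
        ≤ 6 * (∑ j ∈ f.support, (f.coeff j).support.card) - 4 := by
  classical
  rw [eval_eq_sum_terms, ← card_terms]
  exact thm_1 _ _ _ a b ha

/-- **Avendaño 2009, Theorem 1**, "Moreover" clause (`b/a > 0`), for `f ∈ K[x][y]` with `t`
non-zero terms read off `f`. [cite: Avendano2009, Thm. 1 ("Moreover", b/a > 0), doi:10.1016/j.jsc.2008.02.016 p.1281 L21–23] -/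
theorem thm_1_moreover_pos_of_bivariate (f : Polynomial (Polynomial K)) (a b : K)
    (hab : 0 < b / a) (hg : f.eval (C a * X + C b) ≠ 0) :
    (f.eval (C a * X + C b)).roots.countP (fun x => x < -b / a) + 2 ≤
        2 * ∑ j ∈ f.support, (f.coeff j).support.card ∧
    (f.eval (C a * X + C b)).roots.countP (fun x => -b / a < x ∧ x < 0) + 2 ≤
        2 * ∑ j ∈ f.support, (f.coeff j).support.card ∧
    (f.eval (C a * X + C b)).roots.countP (fun x => 0 < x) + 2 ≤
        2 * ∑ j ∈ f.support, (f.coeff j).support.card := by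
  classical
  rw [eval_eq_sum_terms] at hg ⊢
  rw [← card_terms]
  exact thm_1_moreover_pos _ _ _ a b hab hg

/-- **Avendaño 2009, Theorem 1**, "Moreover" clause (`b/a < 0`), for `f ∈ K[x][y]` with `t`
non-zero terms read off `f`. [cite: Avendano2009, Thm. 1 ("Moreover", b/a < 0), doi:10.1016/j.jsc.2008.02.016 p.1281 L21–23] -/
theorem thm_1_moreover_neg_of_bivariate (f : Polynomial (Polynomial K)) (a b : K)
    (hab : b / a < 0) (hg : f.eval (C a * X + C b) ≠ 0) :
    (f.eval (C a * X + C b)).roots.countP (fun x => x < 0) + 2 ≤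
        2 * ∑ j ∈ f.support, (f.coeff j).support.card ∧
    (f.eval (C a * X + C b)).roots.countP (fun x => 0 < x ∧ x < -b / a) + 2 ≤
        2 * ∑ j ∈ f.support, (f.coeff j).support.card ∧
    (f.eval (C a * X + C b)).roots.countP (fun x => -b / a < x) + 2 ≤
        2 * ∑ j ∈ f.support, (f.coeff j).support.card := by
  classical
  rw [eval_eq_sum_terms] at hg ⊢
  rw [← card_terms]
  exact thm_1_moreover_neg _ _ _ a b hab hg

end Bivariate

/-! ## §3, Proposition 8: checking a linear factor through the specialisations `f(x, xⁿ)` -/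

section Prop8

/-! Over a real closed field `K` (an ordered field in which odd-degree polynomials have roots,
Mathlib `IsRealClosed`; for `K = ℝ` the instance is the tree's
`Literature.ModelTheory.ExponentialFields.isRealClosed_real`, a theorem to be introduced with
`haveI`). -/

variable {K : Type*} [Field K] [LinearOrder K] [IsStrictOrderedRing K] [IsRealClosed K]
variable {ι : Type*} [Fintype ι] (c : ι → K) (α β : ι → ℕ) (a b : K)

omit [LinearOrder K] [IsStrictOrderedRing K] [IsRealClosed K] in
/-- `xⁿ − a x − b` has degree `n` for `n ≥ 2`. [folklore] -/
private theorem natDegree_X_pow_sub (n : ℕ) (hn : 2 ≤ n) :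
    (X ^ n - C a * X - C b : K[X]).natDegree = n := by
  have h1 : (C a * X + C b : K[X]).natDegree ≤ 1 := natDegree_linear_le
  have h2 : (X ^ n - C a * X - C b : K[X]) = X ^ n - (C a * X + C b) := by ring
  rw [h2, natDegree_sub_eq_left_of_natDegree_lt] <;> rw [natDegree_X_pow] ; omega

omit [LinearOrder K] [IsStrictOrderedRing K] in
/-- `xⁿ − a x − b` has a root in the real closed field `K` when `n ≥ 3` is odd
(`IsRealClosed.exists_isRoot_of_odd_natDegree`). [folklore] -/
private theorem exists_root_X_pow_sub {n : ℕ} (hn : 3 ≤ n) (hodd : Odd n) :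
    ∃ w : K, (X ^ n - C a * X - C b : K[X]).IsRoot w :=
  IsRealClosed.exists_isRoot_of_odd_natDegree
    (by rw [natDegree_X_pow_sub a b n (by omega)]; exact hodd)

omit [IsRealClosed K] in
/-- Distinct odd exponents give distinct real roots, provided `0`, `1`, `−1` are not roots:
if `wⁿ = a w + b = wᵐ` with `n ≠ m` odd then `w ∈ {0, 1, −1}`. [cite: Avendano2009, Prop. 8 (proof)] -/
private theorem root_unique {n m : ℕ} (hn : Odd n) (hnm : n ≠ m) {w : K}
    (hwn : (X ^ n - C a * X - C b : K[X]).IsRoot w) (hwm : (X ^ m - C a * X - C b : K[X]).IsRoot w)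
    (hb0 : b ≠ 0) (hb1 : a + b ≠ 1) (hb2 : a - b ≠ 1) : False := by
  simp only [IsRoot.def, eval_sub, eval_pow, eval_X, eval_mul, eval_C] at hwn hwm
  have hw0 : w ≠ 0 := by rintro rfl; apply hb0; simp [zero_pow hn.pos.ne'] at hwn; linarith
  have hw1 : w ≠ 1 := by rintro rfl; apply hb1; simp at hwn; linarith
  have hw2 : w ≠ -1 := by rintro rfl; apply hb2; rw [hn.neg_one_pow] at hwn; linarith
  have heq : w ^ n = w ^ m := by linarith
  -- `|w| ^ n = |w| ^ m` with `n ≠ m` forces `|w| = 1`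
  have habs : |w| ^ n = |w| ^ m := by rw [← abs_pow, ← abs_pow, heq]
  have hw : |w| = 1 := by
    by_contra hne
    rcases lt_or_gt_of_ne hne with hlt | hgt
    · exact hnm (pow_right_injective₀ (abs_pos.mpr hw0) (ne_of_lt hlt) habs)
    · exact hnm (pow_right_injective₀ (abs_pos.mpr hw0) (ne_of_gt hgt) habs)
  rcases abs_eq (zero_le_one) |>.mp hw with h | h
  · exact hw1 h
  · exact hw2 h

/-- **Avendaño 2009, Proposition 8** (p. 1283), CORRECTED HYPOTHESIS: "Let `f = Σᵢ aᵢ x^{αᵢ} y^{βᵢ}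
∈ ℝ[x, y]` [with `t` terms]. Let `a, b ∈ ℝ` be such that `b ≠ |1 − a|`. Then
`y − ax − b ∣ f ⟺ xⁿ − ax − b ∣ f(x, xⁿ)` for at least `6t − 3` odd integers `n ≥ 3`."
Typed ≠ printed: the printed hypothesis `b ≠ |1 − a|` is INSUFFICIENT (see
`prop_8_asPrinted_counterexample`: `(a, b) = (0, 0)`, `f = x⁷`); the printed proof needs the real
roots `wₙ` of `xⁿ − ax − b` chosen for the different `n` to be pairwise distinct, which holds as soon
as none of `0, 1, −1` is such a root, i.e. under `b ≠ 0 ∧ a + b ≠ 1 ∧ a − b ≠ 1` (the printed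
`wⁿⁱ⁻ⁿʲ = 1 ⟹ w = ±1` forgets `w = 0`, and `b ≠ |1 − a|` excludes `w = 1` only when `a ≤ 1` and
never `w = −1`). With that hypothesis the statement and its proof are as printed: `f` is
`Σᵢ (cᵢ x^{αᵢ}) y^{βᵢ} ∈ K[x][y]`, `y − ax − b ∣ f` is divisibility by `Y − C(aX + b)` in
`K[x][y]`, `f(x, xⁿ) = Σᵢ cᵢ x^{αᵢ} x^{nβᵢ}`, and "at least `6t − 3` odd integers `n ≥ 3`" is a
finset of such `n` of cardinality `≥ 6t − 3`; `K` is any real closed (ordered) field — the print's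
`ℝ` (instance: the tree's `isRealClosed_real`). The algorithm TEST and its bit-complexity analysis
(§3, p. 1283–1284) are not typed.
[cite: Avendano2009, Prop. 8, doi:10.1016/j.jsc.2008.02.016 p.1283 L69–85 (hypothesis corrected)] -/
theorem prop_8 (hb0 : b ≠ 0) (hb1 : a + b ≠ 1) (hb2 : a - b ≠ 1) :
    (X - C (C a * X + C b)) ∣ (∑ i, monomial (β i) (C (c i) * X ^ (α i)) : Polynomial K[X]) ↔
      ∃ S : Finset ℕ, 6 * Fintype.card ι - 3 ≤ S.card ∧ ∀ n ∈ S, Odd n ∧ 3 ≤ n ∧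
        (X ^ n - C a * X - C b : K[X]) ∣ ∑ i, C (c i) * X ^ (α i) * (X ^ n) ^ (β i) := by
  classical
  set F : Polynomial K[X] := ∑ i, monomial (β i) (C (c i) * X ^ (α i)) with hF_def
  have hFeval : ∀ q : K[X], F.eval q = ∑ i, C (c i) * X ^ (α i) * q ^ (β i) := fun q => by
    rw [hF_def, eval_finsetSum]; simp only [eval_monomial]
  rw [dvd_iff_isRoot, IsRoot.def]
  constructor
  · -- `⇒`: `xⁿ − (ax + b)` divides `f(x, xⁿ) − f(x, ax + b) = f(x, xⁿ)` for every `n`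
    intro h0
    refine ⟨(Finset.range (6 * Fintype.card ι - 3)).image (fun k => 2 * k + 3), ?_, ?_⟩
    · rw [Finset.card_image_of_injective _ (fun k l hkl => by simpa using hkl), Finset.card_range]
    · intro n hn
      obtain ⟨k, -, rfl⟩ := Finset.mem_image.mp hn
      refine ⟨⟨k + 1, by ring⟩, by omega, ?_⟩
      have hd := sub_dvd_eval_sub (X ^ (2 * k + 3)) (C a * X + C b) F
      rw [h0, sub_zero, hFeval] at hd
      have he : (X ^ (2 * k + 3) - (C a * X + C b) : K[X]) = X ^ (2 * k + 3) - C a * X - C b := by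
        ring
      rwa [he] at hd
  · -- `⇐`: `6t − 3` distinct real roots of `g = f(x, ax + b)` force `g = 0` by Theorem 1
    rintro ⟨S, hS, hSn⟩
    by_contra hg
    rw [hFeval] at hg
    -- choose a real root `w n` of `xⁿ − ax − b` for each `n ∈ S`
    have hw : ∀ n ∈ S, ∃ w : K, (X ^ n - C a * X - C b : K[X]).IsRoot w := fun n hn =>
      exists_root_X_pow_sub a b (hSn n hn).2.1 (hSn n hn).1
    choose! w hw using hw
    have hinj : Set.InjOn w S := by
      intro n hn m hm hnm
      by_contra hne
      exact root_unique a b (hSn n hn).1 hne (hw n hn) (hnm ▸ hw m hm) hb0 hb1 hb2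
    -- every `w n` is a root of `g`
    set g := ∑ i, C (c i) * X ^ (α i) * (C a * X + C b) ^ (β i) with hg_def
    have hroot : ∀ n ∈ S, g.IsRoot (w n) := by
      intro n hn
      have h1 : ((X ^ n - C a * X - C b : K[X])).eval (w n) = 0 := hw n hn
      have h2 := eval_eq_zero_of_dvd_of_eval_eq_zero (hSn n hn).2.2 h1
      have h3 : a * w n + b = w n ^ n := by
        simp only [eval_sub, eval_pow, eval_X, eval_mul, eval_C] at h1; linarith
      rw [IsRoot.def, hg_def, eval_finsetSum]
      rw [eval_finsetSum] at h2
      rw [← h2]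
      refine Finset.sum_congr rfl fun i _ => ?_
      simp only [eval_mul, eval_C, eval_pow, eval_X, eval_add, h3]
    -- hence at least `6t − 3` distinct roots, contradicting Theorem 1
    have hcard : S.card ≤ g.roots.toFinset.card := by
      rw [← Finset.card_image_of_injOn hinj]
      refine Finset.card_le_card fun x hx => ?_
      obtain ⟨n, hn, rfl⟩ := Finset.mem_image.mp hx
      exact Multiset.mem_toFinset.mpr ((mem_roots hg).mpr (hroot n hn))
    have hι : 0 < Fintype.card ι := by
      rw [Fintype.card_pos_iff]; by_contra hι
      rw [not_nonempty_iff] at hι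
      exact hg (Fintype.sum_empty _)
    have h1 := thm_1_card_roots_le c α β a b hg
    rw [← hg_def] at h1
    omega

omit [Fintype ι] in
/-- Proposition 8, direction `⇒`, holds for EVERY `n` and over any commutative ring:
`y − ax − b ∣ f` implies `xⁿ − ax − b ∣ f(x, xⁿ)` (since `xⁿ − (ax+b)` divides
`f(x, xⁿ) − f(x, ax+b)`). [cite: Avendano2009, Prop. 8 (direction ⇒), doi:10.1016/j.jsc.2008.02.016 p.1283 L69–76] -/
theorem prop_8_forward {R : Type*} [CommRing R] (s : Finset ι) (c : ι → R) (α β : ι → ℕ) (a b : R)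
    (h : (X - C (C a * X + C b)) ∣ (∑ i ∈ s, monomial (β i) (C (c i) * X ^ (α i)) : Polynomial R[X]))
    (n : ℕ) :
    (X ^ n - C a * X - C b : R[X]) ∣ ∑ i ∈ s, C (c i) * X ^ (α i) * (X ^ n) ^ (β i) := by
  set F : Polynomial R[X] := ∑ i ∈ s, monomial (β i) (C (c i) * X ^ (α i)) with hF_def
  have hFeval : ∀ q : R[X], F.eval q = ∑ i ∈ s, C (c i) * X ^ (α i) * q ^ (β i) := fun q => by
    rw [hF_def, eval_finsetSum]; simp only [eval_monomial]
  have h0 : F.eval (C a * X + C b) = 0 := (dvd_iff_isRoot.mp h)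
  have hd := sub_dvd_eval_sub (X ^ n) (C a * X + C b) F
  rw [h0, sub_zero, hFeval] at hd
  have he : (X ^ n - (C a * X + C b) : R[X]) = X ^ n - C a * X - C b := by ring
  rwa [he] at hd

/-- **Proposition 8 as printed is false.** With `(a, b) = (0, 0)` — allowed by the printed
hypothesis `b ≠ |1 − a|` since `0 ≠ 1` — and `f = x⁷` (`t = 1`, `6t − 3 = 3`): `xⁿ ∣ f(x, xⁿ) = x⁷`
for the three odd integers `n = 3, 5, 7`, yet `y ∤ x⁷`. (A second family: `(a, b) = (0, −1)`,
`f = x^m + y` with `2n ∣ m` for `6t − 3 = 9` odd `n`.) [cite: Avendano2009, Prop. 8 (statement as printed; counterexample)] -/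
theorem prop_8_asPrinted_counterexample :
    ∃ (a b : ℝ) (c : Fin 1 → ℝ) (α β : Fin 1 → ℕ), b ≠ |1 - a| ∧
      (∃ S : Finset ℕ, 6 * Fintype.card (Fin 1) - 3 ≤ S.card ∧ ∀ n ∈ S, Odd n ∧ 3 ≤ n ∧
        (X ^ n - C a * X - C b : ℝ[X]) ∣ ∑ i, C (c i) * X ^ (α i) * (X ^ n) ^ (β i)) ∧
      ¬ ((X - C (C a * X + C b)) ∣
          (∑ i, monomial (β i) (C (c i) * X ^ (α i)) : Polynomial ℝ[X])) := by
  refine ⟨0, 0, fun _ => 1, fun _ => 7, fun _ => 0, by simp, ⟨{3, 5, 7}, by decide, ?_⟩, ?_⟩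
  · intro n hn
    simp only [Finset.mem_insert, Finset.mem_singleton] at hn
    have hdvd : ∀ m : ℕ, m ≤ 7 → (X ^ m - C (0:ℝ) * X - C 0 : ℝ[X]) ∣
        ∑ i : Fin 1, C ((fun _ => (1:ℝ)) i) * X ^ ((fun _ => 7) i) * (X ^ m) ^ ((fun _ => 0) i) := by
      intro m hm
      simp only [C_0, zero_mul, sub_zero, Fin.sum_univ_one, C_1, one_mul, pow_zero, mul_one]
      exact pow_dvd_pow X hm
    rcases hn with rfl | rfl | rfl
    · exact ⟨⟨1, rfl⟩, le_rfl, hdvd 3 (by norm_num)⟩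
    · exact ⟨⟨2, rfl⟩, by norm_num, hdvd 5 (by norm_num)⟩
    · exact ⟨⟨3, rfl⟩, by norm_num, hdvd 7 (by norm_num)⟩
  · rw [dvd_iff_isRoot, IsRoot.def, eval_finsetSum]
    simp only [Fin.sum_univ_one, eval_monomial, C_0, zero_mul, zero_add, pow_zero, mul_one, C_1,
      one_mul]
    exact pow_ne_zero 7 X_ne_zero

end Prop8

/-! ## The same family on one sign cell: Avendaño's linear bound next to KPT 2015, Cor. 14 -/

section Cell

variable {K : Type*} [Field K] [LinearOrder K] [IsStrictOrderedRing K]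
variable {ι : Type*} [Fintype ι] (c : ι → K) (α β : ι → ℕ) (a b : K)

omit [LinearOrder K] [IsStrictOrderedRing K] [Fintype ι] in
/-- The zeros of `g ≠ 0` satisfying a predicate are at most the roots counted with multiplicity
there. [folklore] -/
private theorem encard_zeros_le_countP {g : K[X]} (hg : g ≠ 0) (Q : K → Prop) [DecidablePred Q] :
    {x : K | Q x ∧ g.eval x = 0}.encard ≤ (g.roots.countP Q : ℕ∞) := by
  classical
  have hset : {x : K | Q x ∧ g.eval x = 0} = ↑(g.roots.toFinset.filter Q) := by
    ext x
    simp only [Set.mem_setOf_eq, Finset.coe_filter, Multiset.mem_toFinset, mem_roots hg, IsRoot.def]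
    exact and_comm
  rw [hset, Set.encard_coe_eq_coe_finsetCard]
  have : (g.roots.toFinset.filter Q).card ≤ g.roots.countP Q := by
    rw [← Multiset.toFinset_filter, Multiset.countP_eq_card_filter]
    exact Multiset.toFinset_card_le _
  exact_mod_cast this

omit [LinearOrder K] [IsStrictOrderedRing K] in
/-- `g(x)` written out: `Σᵢ cᵢ x^{αᵢ}(ax + b)^{βᵢ}`. [folklore] -/
private theorem eval_family (x : K) :
    (∑ i, C (c i) * X ^ (α i) * (C a * X + C b) ^ (β i)).eval x =
      ∑ i, c i * (x ^ α i * (a * x + b) ^ β i) := by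
  rw [eval_finsetSum]
  refine Finset.sum_congr rfl fun i _ => ?_
  simp only [eval_mul, eval_C, eval_pow, eval_X, eval_add]
  ring

/-- **Theorem 1 on the sign cell `{x > 0, ax + b > 0}` — the statement shape of
`Literature.Computability.AlgebraicComplexity.KoiranPortierTavenas2015.KPT2015_cor_14`.** For the
family `f = Σᵢ cᵢ x^{αᵢ}(ax + b)^{βᵢ}` with `t = #ι` terms and NATURAL exponents, if the
polynomial is not zero then its zeros in the open cell `{x > 0, ax + b > 0}` number at most
`2t − 2` (even counted with multiplicity: the cell is one of the printed "Moreover" intervals, or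
`(0, ∞)` on which a `t`-sparse polynomial has at most `t − 1` sign variations when `a = 0` or
`b = 0`). KPT 2015, Cor. 14 bounds the same count for REAL exponents by `2t³/3 + 5t` (Wronskians);
for natural exponents Avendaño's Descartes argument is linear in `t`. A dictionary juxtaposition:
nothing here improves KPT's real-exponent statement.
[cite: Avendano2009, Thm. 1 ("Moreover"), doi:10.1016/j.jsc.2008.02.016 p.1281 L21–23] -/
theorem encard_zeros_cell_le (hg : ∑ i, C (c i) * X ^ (α i) * (C a * X + C b) ^ (β i) ≠ 0) :
    {x : K | 0 < x ∧ 0 < a * x + b ∧ ∑ i, c i * (x ^ α i * (a * x + b) ^ β i) = 0}.encard ≤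
      ((2 * Fintype.card ι - 2 : ℕ) : ℕ∞) := by
  classical
  set g := ∑ i, C (c i) * X ^ (α i) * (C a * X + C b) ^ (β i) with hg_def
  -- the cell zeros inside `{x | Q x ∧ g(x) = 0}` for an interval predicate `Q`, then Theorem 1
  have main : ∀ (Q : K → Prop) [DecidablePred Q], (∀ x, 0 < x → 0 < a * x + b → Q x) →
      g.roots.countP Q + 2 ≤ 2 * Fintype.card ι →
      {x : K | 0 < x ∧ 0 < a * x + b ∧ ∑ i, c i * (x ^ α i * (a * x + b) ^ β i) = 0}.encard ≤
        ((2 * Fintype.card ι - 2 : ℕ) : ℕ∞) := by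
    intro Q _ hQ hcount
    have hsub : {x : K | 0 < x ∧ 0 < a * x + b ∧ ∑ i, c i * (x ^ α i * (a * x + b) ^ β i) = 0} ⊆
        {x : K | Q x ∧ g.eval x = 0} := by
      rintro x ⟨hx, hax, hz⟩
      exact ⟨hQ x hx hax, by rw [hg_def, eval_family]; exact hz⟩
    refine (Set.encard_le_encard hsub).trans ((encard_zeros_le_countP hg Q).trans ?_)
    exact_mod_cast (show g.roots.countP Q ≤ 2 * Fintype.card ι - 2 by omega)
  have hι : 0 < Fintype.card ι := by
    rw [Fintype.card_pos_iff]; by_contra hι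
    rw [not_nonempty_iff] at hι
    exact hg (by rw [hg_def]; exact Fintype.sum_empty _)
  -- empty cell: nothing to count
  have empty : (∀ x : K, 0 < x → ¬ 0 < a * x + b) →
      {x : K | 0 < x ∧ 0 < a * x + b ∧ ∑ i, c i * (x ^ α i * (a * x + b) ^ β i) = 0}.encard ≤
        ((2 * Fintype.card ι - 2 : ℕ) : ℕ∞) := by
    intro h
    have : {x : K | 0 < x ∧ 0 < a * x + b ∧ ∑ i, c i * (x ^ α i * (a * x + b) ^ β i) = 0} = ∅ :=
      Set.eq_empty_of_forall_notMem fun x hx => h x hx.1 hx.2.1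
    rw [this, Set.encard_empty]; exact bot_le
  -- the sparse cases `a = 0` or `b = 0`: positive roots of a `t`-sparse polynomial
  have sparse : ∀ (d : ι → K) (γ : ι → ℕ), g = ∑ i, C (d i) * X ^ (γ i) →
      g.roots.countP (fun x => 0 < x) + 2 ≤ 2 * Fintype.card ι := by
    intro d γ hgs
    have hs := sparse_case d γ (hgs ▸ hg)
    rw [← hgs] at hs
    have hle : g.roots.countP (fun x => 0 < x) ≤ g.roots.countP (fun x => x ≠ 0) := by
      rw [Multiset.countP_eq_card_filter, Multiset.countP_eq_card_filter]
      exact Multiset.card_le_card (Multiset.monotone_filter_right g.roots fun x hx => hx.ne')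
    omega
  by_cases ha : a = 0
  · by_cases hb : 0 < b
    · refine main (fun x => 0 < x) (fun x hx _ => hx) (sparse (fun i => c i * b ^ (β i)) α ?_)
      rw [hg_def]
      refine Finset.sum_congr rfl fun i _ => ?_
      rw [ha, C_0, zero_mul, zero_add, ← C_pow, C_mul]; ring
    · exact empty fun x _ h => hb (by rwa [ha, zero_mul, zero_add] at h)
  by_cases hb : b = 0
  · rcases lt_or_gt_of_ne ha with ha' | ha'
    · exact empty fun x hx h => by
        rw [hb, add_zero] at h
        have := mul_neg_of_neg_of_pos ha' hx
        linarith
    · refine main (fun x => 0 < x) (fun x hx _ => hx) (sparse (fun i => c i * a ^ (β i))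
        (fun i => α i + β i) ?_)
      rw [hg_def]
      refine Finset.sum_congr rfl fun i _ => ?_
      rw [hb, C_0, add_zero, mul_pow, ← C_pow, C_mul, pow_add]; ring
  rcases lt_or_gt_of_ne (div_ne_zero hb ha) with hs | hs
  · -- `b/a < 0`: the cell is `(−b/a, ∞)` if `a > 0`, `(0, −b/a)` if `a < 0`
    obtain ⟨_, h2, h3⟩ := thm_1_moreover_neg c α β a b hs hg
    rcases lt_or_gt_of_ne ha with ha' | ha'
    · refine main (fun x => 0 < x ∧ x < -b / a) (fun x hx hax => ⟨hx, ?_⟩) h2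
      rw [lt_div_iff_of_neg ha']; linarith
    · refine main (fun x => -b / a < x) (fun x hx hax => ?_) h3
      rw [div_lt_iff₀ ha']; linarith
  · -- `b/a > 0`: the cell is `(0, ∞)` if `a > 0`, empty if `a < 0`
    obtain ⟨_, _, h3⟩ := thm_1_moreover_pos c α β a b hs hg
    rcases lt_or_gt_of_ne ha with ha' | ha'
    · refine empty fun x hx hax => ?_
      have hb' : b < 0 := by
        rcases div_pos_iff.mp hs with ⟨_, h⟩ | ⟨h, _⟩
        · exact absurd ha' (not_lt.mpr h.le)
        · exact h
      have := mul_neg_of_neg_of_pos ha' hx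
      linarith
    · exact main (fun x => 0 < x) (fun x hx _ => hx) h3

/-- The same, with KPT's hypothesis "`f` does not vanish identically on the cell" in place of
`g ≠ 0`. [cite: Avendano2009, Thm. 1 ("Moreover"), doi:10.1016/j.jsc.2008.02.016 p.1281 L21–23] -/
theorem encard_zeros_cell_le'
    (hne : ∃ x : K, 0 < x ∧ 0 < a * x + b ∧ ∑ i, c i * (x ^ α i * (a * x + b) ^ β i) ≠ 0) :
    {x : K | 0 < x ∧ 0 < a * x + b ∧ ∑ i, c i * (x ^ α i * (a * x + b) ^ β i) = 0}.encard ≤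
      ((2 * Fintype.card ι - 2 : ℕ) : ℕ∞) := by
  refine encard_zeros_cell_le c α β a b fun h0 => ?_
  obtain ⟨x, _, _, hx⟩ := hne
  apply hx
  rw [← eval_family, h0, eval_zero]

end Cell

end Avendano2009

end Literature.Algebra.Polynomial

end

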